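import Literature.Probability.LatticeModels.HighDimTrivialityUniform
import Literature.Probability.LatticeModels.CriticalTwoPointBounds
import Literature.Probability.LatticeModels.CriticalGibbsUniqueness
import Literature.Barriers.CriticalPhenomena.IsingTreeDiagramBoundGraph
import Literature.Probability.LatticeModels.OnsagerSzego
import Literature.Probability.LatticeModels.OnsagerToeplitzDecay
import HarnessLib

/-!
# High-dimensional triviality of Ising scaling limits, IV (proofs): uniform smallness of `S(μ; L, r)`

Trunk: StatMech (G02); family `crit-ising` (crit-ising.S13). Proof companion of
`HighDimTrivialityUniform`: it proves the **uniform smallness of `S(μ; L, r)`** — for the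
nearest-neighbour ferromagnetic Ising model on `ℤ^d`, `d ≥ 4`, and `r ≥ 1`,
`sup {Σ_L⁻² ∑_{x ∈ Λ_{rL}⁴} |U₄^μ(x)| : 0 ≤ β ≤ β_c, μ ∈ 𝒢(β,0)} → 0` as `L → ∞` —
from the named facts `aizenman_treeDiagramBound` (Aizenman 1982), `panis_ursellFourSum_le_four`
(Panis 2023, Cor. 1.8, `d = 4`, sharp-length window), `panis_ursellFourSum_le` (Panis 2023,
Thm 5.5, `d ≥ 5`) and the structure of `𝒢(β, 0)` up to `β_c` (uniqueness and the free state),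
all other inputs being theorems of the tree (`ursellFourSum_uniformlySmall_of_facts`). The
statement is DERIVED (no source prints the uniformity in `β`); it is the explicit conclusion of
`ursellFourSum_uniformlySmall_of_facts'` / `ursellFourSum_uniformlySmall_of_facts` and carries no
name of its own (the assembly `HighDimTrivialityAssembly` takes it as the hypothesis `hU`).

## The argument (no single printed source; the regimes are those of Panis 2023, §1.2.1)

Write `S(v) = ⟨σ₀σ_v⟩_μ` (`= ⟨σ₀σ_v⟩^∅_β`, the state being the translation-invariant free
state), `χ = ∑_v S(v)`, `χ_m = ∑_{v ∈ Λ_m} S(v)`.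

1. *Tree diagram bound, smeared* (`sum_abs_connectedFour_le`): for `S` summable,
   `∑_{x ∈ Λ⁴} |U₄(x)| ≤ 2 ∑_u (∑_{a ∈ Λ} S(u-a))⁴ ≤ 2 |Λ| χ⁴`.
2. *Lower bound on `Σ_L`* (`card_mul_sum_box_le_blockSpinVariance`): `Σ_L ≥ |Λ_m| χ_m` for
   `2m ≤ ⌊L⌋` (Griffiths I), whence (`ursellFourSum_le_of_summable`)
   `S(μ; L, r) ≤ 2 · 12^d r^d χ⁴ / (L^d χ_{⌊L⌋/2}²)` for `L ≥ 2`.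
3. *Saturation of the susceptibility* (`susceptibility_saturation`): if `φ_β(S₀) < 1/2` for some
   finite `S₀ ∋ 0`, `S₀ ⊆ Λ_K` (`φ` = Duminil-Copin–Tassion's `dctIsingPhi`), then summing the
   modified Simon–Lieb inequality (a theorem of the tree, `twoPointFree_le_dct_sum`) over the tail
   gives `U_S(R) ≤ φ_β(S₀) U_S(R-K-1)` (`tailSum_le_mul_tailSum`), hence `S` is summable,
   `χ ≤ 2 χ_K` and `χ_m ≥ χ/2` for all `m ≥ K`.
4. *High temperature* (`ursellFourSum_le_of_le_smallBeta`): there is `β₀ > 0` with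
   `φ_{β₀}({0}) < 1/2`; for `β ≤ β₀`, `χ(β) ≤ χ(β₀) ≤ 2` (step 3 with `K = 0` and Griffiths'
   monotonicity in `β`), so `S(μ; L, r) ≤ 32 · 12^d r^d / L^d`.
5. *Off the sharp-length window, `d = 4`* (`ursellFourSum_le_offWindow`): if at scale `L/M` some
   `S₀ ∋ 0` inside `Λ_{16L/M}` has `φ_β(S₀) < 1/2`, then with `K = ⌊16L/M⌋`: `χ ≤ 2 χ_K ≤
   2 C₁ (K+1)²` by the infrared bound at `β_c` (a theorem of the tree,
   `twoPointFree_criticalBeta_upper_holds`, with `χ_n ≤ C₁ (n+1)²` in `d = 4`,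
   `exists_sum_box_twoPointFree_le_sq`) and `χ_{⌊L⌋/2} ≥ χ/2` (`M ≥ 64`), so
   `S(μ; L, r) ≤ 32 · 12⁴ · 17⁴ C₁² r⁴ / M⁴`.
6. *In the window, `d = 4`*: `S(μ; L, r) ≤ S(μ; L/M, Mr)` (`ursellFourSum_le_dilate`,
   `Σ_{L/M} ≤ Σ_L`) `≤ C (Mr)^γ (log(L/M))^{-c}` by `panis_ursellFourSum_le_four`.
7. *`d ≥ 5`, `β ≥ β₀`*: `panis_ursellFourSum_le` with the constant `C (β₀⁻⁴ ∨ β₀⁻²)`.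

Given `ε`, choose `M` by step 5, then `L₀` by steps 4, 6 (resp. 4, 7).

## Part 8: Aizenman's tree diagram bound in infinite volume (`aizenman_treeDiagramBound`)

The named fact `aizenman_treeDiagramBound` of `HighDimTrivialityUniform` (Aizenman, CMP 86
(1982); as printed in Aizenman, CDM 2020, Lemma 8.1 / eq. (8.2), "for the Ising model on any
finite graph, at `h = 0` and `β ≥ 0` … `|U₄(x₁,…,x₄)| ≤ 2 Σ_u ⟨σ_uσ_{x₁}⟩⟨σ_uσ_{x₂}⟩⟨σ_uσ_{x₃}⟩⟨σ_uσ_{x₄}⟩`",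
and in Aizenman–Duminil-Copin, Ann. of Math. 194 (2021), §1.3, display (tree), for the
infinite-volume state `⟨·⟩_β` on `ℤ^d`) is reduced here to theorems of the tree:

* `treeDiagramBound_freeFinset` — the finite-graph tree diagram bound, a THEOREM of the tree
  (`Literature.Barriers.CriticalPhenomena.treeDiagramBound_holds`, `IsingTreeDiagramBoundGraph`:
  switching lemma for weighted currents), transported to the free state of a finite volume
  `Λ ⊆ ℤ^d` (the induced graph on `↥Λ`, `isingExpect_free_map` of `IsingTransport`);
* `abs_connectedFour_le_treeSum_free` — the infinite-volume inequality for the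
  translation-invariant free state `⟨·⟩^∅_{β,0}`, EVERY `d` and EVERY `β ≥ 0` (Aizenman 1982
  states the bound for infinite-volume limits of finite systems): limit along boxes on the left
  (box limits `hasBoxLimit_isingCorr_free_holds`), domination of the finite-volume right side by
  the infinite-volume series through volume monotonicity `⟨σ_uσ_x⟩^∅_Λ ≤ ⟨σ₀σ_{x-u}⟩^∅_β`
  (the same computation as `HighDimTrivialityTreeBound.treeDiagramBound_dlr_of_treeDiagramBound`,
  which took the finite-graph bound and the structure of `𝒢(β, 0)` as hypotheses);
* `abs_connectedFour_le_treeSum_of_hasUniqueGibbsMeasure` — hence for every `μ ∈ 𝒢(β, 0)`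
  whenever `|𝒢(β, 0)| = 1` (the free DLR state exists: `exists_freeMeasure_holds`);
* `aizenman_treeDiagramBound_three_le`, `aizenman_treeDiagramBound_lt_criticalBeta` — the
  statement of the fact for `d ≥ 3`, `0 ≤ β ≤ β_c`, and for `d ≥ 2`, `0 ≤ β < β_c`, from the
  tree's uniqueness theorems `hasUniqueGibbsMeasure_criticalBeta_holds` (Aizenman–Duminil-Copin–
  Sidoravicius 2015, `d ≥ 3`) and `hasUniqueGibbsMeasure_of_lt_criticalBeta_holds`
  (Lebowitz–Martin-Löf) of `CriticalGibbsUniqueness`;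
* `aizenman_treeDiagramBound_of_hasUniqueGibbsMeasure_two` — the whole fact granted uniqueness
  of the planar critical state `|𝒢(β_c(2), 0)| = 1`, the only input not proved in the tree; it
  follows from `m*(β_c(2)) = 0` (`…_of_spontaneousMagnetization_two`, Lebowitz–Martin-Löf
  criterion `hasUniqueGibbsMeasure_of_plusExpect_spinAt_eq_zero_holds`), i.e. from the planar
  named facts `criticalBeta_two` and `spontaneousMagnetization_two_criticalBetaTwo` of
  `PlanarIsing` (`…_of_planarFacts`), both consequences of `onsager_yang`
  (`…_of_onsager_yang`; Yang 1952, Benettin–Gallavotti–Jona-Lasinio–Stella 1973);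
* `aizenman_treeDiagramBound_holds` — the discharge: `onsager_yang` is a theorem of the tree,
  `OnsagerSzego.onsager_yang_of_wu` (transfer matrix, Toeplitz form of the row correlations,
  strong Szegő limit theorem, Kramers–Wannier duality, Lebowitz–Martin-Löf) fed with Wu's decay
  of the Toeplitz determinants of Onsager's symbol,
  `OnsagerToeplitzDecay.toeplitzDet_onsagerSymbol_exp_decay_holds`; hence `|𝒢(β_c(2), 0)| = 1`
  and the fact, with no residual hypothesis.

## Mathlib

Used: `summable_of_sum_le`, `Summable.tsum_finsetSum`, `Equiv.tsum_eq` (shifts on `ℤ^d`),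
`summable_pow_mul_geometric_of_norm_lt_one`, `Finset.prod_univ_sum`, `Real.rpow_inv_rpow`,
`Real.le_log_iff_exp_le`. No new definitions in this file.
-/

noncomputable section

open MeasureTheory Filter Topology Finset
open Literature.Probability.LatticeModels Literature.Probability.Percolation

namespace Literature.Probability.LatticeModels

variable {d : ℕ}

/-! ### Part 1. Lattice sums: boxes, shells, tails -/

/-- Summability on `ℤ^d` from uniformly bounded partial sums over boxes. [folklore] -/
theorem summable_of_sum_box_le {f : Site d → ℝ} (hf : ∀ x, 0 ≤ f x) {c : ℝ}
    (h : ∀ N : ℕ, ∑ x ∈ box d N, f x ≤ c) : Summable f := by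
  refine summable_of_sum_le (c := c) (fun x => hf x) fun s => ?_
  obtain ⟨N, hN⟩ : ∃ N : ℕ, s ⊆ box d N :=
    ⟨s.sup Site.supNorm, fun x hx => mem_box_iff_supNorm_le.2 (Finset.le_sup (f := Site.supNorm) hx)⟩
  exact (Finset.sum_le_sum_of_subset_of_nonneg hN fun x _ _ => hf x).trans (h N)

/-- A box is the disjoint union of the spheres it contains:
`∑_{x ∈ Λ_N} f(x) = ∑_{m ≤ N} ∑_{‖x‖_∞ = m} f(x)`. [folklore] -/
theorem sum_box_eq_sum_sphere (f : Site d → ℝ) (N : ℕ) :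
    ∑ x ∈ box d N, f x = ∑ m ∈ Finset.range (N + 1), ∑ x ∈ sphere d m, f x := by
  rw [← Finset.sum_fiberwise_of_maps_to (g := Site.supNorm) (t := Finset.range (N + 1))
    (fun x hx => Finset.mem_range.2 (Nat.lt_succ_of_le (mem_box_iff_supNorm_le.1 hx)))]
  refine Finset.sum_congr rfl fun m hm => Finset.sum_congr ?_ fun _ _ => rfl
  ext x
  simp only [Finset.mem_filter, mem_box_iff_supNorm_le, mem_sphere]
  constructor
  · rintro ⟨-, h⟩; exact h
  · intro h; exact ⟨by rw [h]; exact Nat.lt_succ_iff.1 (Finset.mem_range.1 hm), h⟩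

/-- Summability on `ℤ^d` from a bound by a function of the sup norm whose shell sums are
summable: `0 ≤ f(x) ≤ a(‖x‖_∞)` and `∑_m |∂Λ_m| a(m) < ∞`. [folklore] -/
theorem summable_of_supNorm_bound {f : Site d → ℝ} (hf : ∀ x, 0 ≤ f x) {a : ℕ → ℝ}
    (hfa : ∀ x, f x ≤ a (Site.supNorm x))
    (ha : Summable fun m => (#(sphere d m) : ℝ) * a m) : Summable f := by
  have ha0 : ∀ m, 0 ≤ (#(sphere d m) : ℝ) * a m := by
    intro m
    rcases (sphere d m).eq_empty_or_nonempty with h | ⟨x, hx⟩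
    · simp [h]
    · exact mul_nonneg (Nat.cast_nonneg _) ((hf x).trans (by rw [← mem_sphere.1 hx]; exact hfa x))
  refine summable_of_sum_box_le hf (c := ∑' m, (#(sphere d m) : ℝ) * a m) fun N => ?_
  rw [sum_box_eq_sum_sphere]
  calc ∑ m ∈ Finset.range (N + 1), ∑ x ∈ sphere d m, f x
      ≤ ∑ m ∈ Finset.range (N + 1), (#(sphere d m) : ℝ) * a m := by
        refine Finset.sum_le_sum fun m _ => ?_
        calc ∑ x ∈ sphere d m, f x ≤ ∑ x ∈ sphere d m, a m :=
              Finset.sum_le_sum fun x hx => by rw [← mem_sphere.1 hx]; exact hfa x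
          _ = (#(sphere d m) : ℝ) * a m := by rw [Finset.sum_const, nsmul_eq_mul]
    _ ≤ ∑' m, (#(sphere d m) : ℝ) * a m := ha.sum_le_tsum _ fun m _ => ha0 m

/-- `|∂Λ_m| ≤ |Λ_m| = (2m+1)^d ≤ 3^d m^d + 1`. [folklore] -/
theorem card_sphere_le (m : ℕ) : (#(sphere d m) : ℝ) ≤ 3 ^ d * (m : ℝ) ^ d + 1 := by
  have h1 : (#(sphere d m) : ℝ) ≤ (2 * m + 1 : ℝ) ^ d := by
    have := Finset.card_le_card (sphere_subset_box d m)
    rw [card_box] at this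
    exact_mod_cast this
  refine h1.trans ?_
  rcases Nat.eq_zero_or_pos m with rfl | hm
  · simp
  · have : (2 * m + 1 : ℝ) ≤ 3 * m := by
      have : (1 : ℝ) ≤ m := by exact_mod_cast hm
      linarith
    calc (2 * m + 1 : ℝ) ^ d ≤ (3 * m : ℝ) ^ d := by gcongr
      _ = 3 ^ d * (m : ℝ) ^ d := by rw [mul_pow]
      _ ≤ 3 ^ d * (m : ℝ) ^ d + 1 := by linarith

/-- Exponential decay in the sup norm implies summability on `ℤ^d`. [folklore] -/
theorem summable_of_exp_decay {f : Site d → ℝ} (hf : ∀ x, 0 ≤ f x) {C c : ℝ} (hc : 0 < c)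
    (h : ∀ x, f x ≤ C * Real.exp (-c * ‖x‖)) : Summable f := by
  set q : ℝ := Real.exp (-c) with hq
  have hq0 : 0 < q := Real.exp_pos _
  have hq1 : q < 1 := Real.exp_lt_one_iff.2 (by linarith)
  have hqn : ‖q‖ < 1 := by rwa [Real.norm_eq_abs, abs_of_pos hq0]
  have hexp : ∀ x : Site d, Real.exp (-c * ‖x‖) = q ^ Site.supNorm x := fun x => by
    rw [Site.norm_eq_supNorm, hq, ← Real.exp_nat_mul]; ring_nf
  refine summable_of_supNorm_bound hf (a := fun m => |C| * q ^ m) (fun x => ?_) ?_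
  · calc f x ≤ C * Real.exp (-c * ‖x‖) := h x
      _ ≤ |C| * Real.exp (-c * ‖x‖) := mul_le_mul_of_nonneg_right (le_abs_self C) (Real.exp_pos _).le
      _ = |C| * q ^ Site.supNorm x := by rw [hexp]
  · have hs : Summable fun m : ℕ => |C| * ((3 : ℝ) ^ d * ((m : ℝ) ^ d * q ^ m) + q ^ m) :=
      ((((summable_pow_mul_geometric_of_norm_lt_one d hqn).mul_left _).add
        (summable_geometric_of_lt_one hq0.le hq1)).mul_left _)
    refine Summable.of_nonneg_of_le (fun m => by positivity) (fun m => ?_) hs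
    calc (#(sphere d m) : ℝ) * (|C| * q ^ m) = |C| * ((#(sphere d m) : ℝ) * q ^ m) := by ring
      _ ≤ |C| * ((3 ^ d * (m : ℝ) ^ d + 1) * q ^ m) := by
          gcongr
          exact card_sphere_le m
      _ = |C| * (3 ^ d * ((m : ℝ) ^ d * q ^ m) + q ^ m) := by ring



section Tails

variable {S : Site d → ℝ}

/-- The terms of a tail sum of a non-negative function are non-negative. [folklore] -/
theorem tailSum_term_nonneg (hS : ∀ x, 0 ≤ S x) (R : ℕ) (x : Site d) :
    0 ≤ (if R ≤ Site.supNorm x then S x else 0) := by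
  split_ifs
  · exact hS x
  · exact le_rfl

/-- The terms of a tail sum are dominated by the function. [folklore] -/
theorem tailSum_term_le (hS : ∀ x, 0 ≤ S x) (R : ℕ) (x : Site d) :
    (if R ≤ Site.supNorm x then S x else 0) ≤ S x := by
  split_ifs
  · exact le_rfl
  · exact hS x

/-- The terms of a tail sum of a summable non-negative function are summable. [folklore] -/
theorem summable_tailSum_term (hS : ∀ x, 0 ≤ S x) (hsum : Summable S) (R : ℕ) :
    Summable fun x => if R ≤ Site.supNorm x then S x else 0 :=
  Summable.of_nonneg_of_le (tailSum_term_nonneg hS R) (tailSum_term_le hS R) hsum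

/-- `U_S(R) ≥ 0` for `S ≥ 0`. [folklore] -/
theorem tailSum_nonneg (hS : ∀ x, 0 ≤ S x) (R : ℕ) : 0 ≤ tailSum S R :=
  tsum_nonneg (tailSum_term_nonneg hS R)

/-- `U_S(R) ≤ ∑_x S(x)` for `S ≥ 0` summable. [folklore] -/
theorem tailSum_le_tsum (hS : ∀ x, 0 ≤ S x) (hsum : Summable S) (R : ℕ) :
    tailSum S R ≤ ∑' x, S x :=
  (summable_tailSum_term hS hsum R).tsum_le_tsum (tailSum_term_le hS R) hsum

/-- `U_S(0) = ∑_x S(x)`. [folklore] -/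
theorem tailSum_zero (S : Site d → ℝ) : tailSum S 0 = ∑' x, S x := by
  simp [tailSum]

/-- Tail sums decrease with the radius: `U_S(R') ≤ U_S(R)` for `R ≤ R'` (`S ≥ 0` summable).
[folklore] -/
theorem tailSum_antitone (hS : ∀ x, 0 ≤ S x) (hsum : Summable S) {R R' : ℕ} (h : R ≤ R') :
    tailSum S R' ≤ tailSum S R := by
  refine (summable_tailSum_term hS hsum R').tsum_le_tsum (fun x => ?_)
    (summable_tailSum_term hS hsum R)
  by_cases hx : R' ≤ Site.supNorm x
  · rw [if_pos hx, if_pos (h.trans hx)]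
  · rw [if_neg hx]
    exact tailSum_term_nonneg hS R x

/-- `∑_{x ∈ Λ_n} S(x) + U_S(n+1) = ∑_x S(x)`. [folklore] -/
theorem sum_box_add_tailSum (hsum : Summable S) (n : ℕ) :
    ∑ x ∈ box d n, S x + tailSum S (n + 1) = ∑' x, S x := by
  have h1 : ∑ x ∈ box d n, S x = ∑' x, if Site.supNorm x ≤ n then S x else 0 := by
    rw [tsum_eq_sum (s := box d n)]
    · refine Finset.sum_congr rfl fun x hx => ?_
      rw [if_pos (mem_box_iff_supNorm_le.1 hx)]
    · intro x hx
      rw [if_neg (fun h => hx (mem_box_iff_supNorm_le.2 h))]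
  have hs1 : Summable fun x => if Site.supNorm x ≤ n then S x else 0 := by
    refine summable_of_ne_finset_zero (s := box d n) fun x hx => ?_
    rw [if_neg (fun h => hx (mem_box_iff_supNorm_le.2 h))]
  have hs2 : Summable fun x => if n + 1 ≤ Site.supNorm x then S x else 0 := by
    have : (fun x => if n + 1 ≤ Site.supNorm x then S x else 0) =
        fun x => S x - (if Site.supNorm x ≤ n then S x else 0) := by
      funext x
      by_cases hx : Site.supNorm x ≤ n
      · rw [if_pos hx, if_neg (by omega), sub_self]
      · rw [if_neg hx, if_pos (by omega), sub_zero]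
    rw [this]
    exact hsum.sub hs1
  rw [h1, tailSum, ← hs1.tsum_add hs2]
  refine tsum_congr fun x => ?_
  by_cases hx : Site.supNorm x ≤ n
  · rw [if_pos hx, if_neg (by omega), add_zero]
  · rw [if_neg hx, if_pos (by omega), zero_add]

/-- Shifting the variable in a tail sum: for `‖y‖_∞ ≤ K + 1` and `R ≥ K + 1`,
`∑_{‖z‖ ≥ R} S(z - y) ≤ U_S(R - (K+1))`. [folklore] -/
theorem tsum_shift_tail_le (hS : ∀ x, 0 ≤ S x) (hsum : Summable S) {K R : ℕ} {y : Site d}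
    (hy : Site.supNorm y ≤ K + 1) :
    ∑' z, (if R ≤ Site.supNorm z then S (z - y) else 0) ≤ tailSum S (R - (K + 1)) := by
  have e := (Equiv.subRight y)  -- z ↦ z - y
  have hre : ∑' z, (if R ≤ Site.supNorm z then S (z - y) else 0) =
      ∑' w, (if R ≤ Site.supNorm (w + y) then S w else 0) := by
    rw [← (Equiv.addRight y).tsum_eq]
    refine tsum_congr fun w => ?_
    simp [Equiv.addRight]
  rw [hre, tailSum]
  have hs' : Summable fun w => if R ≤ Site.supNorm (w + y) then S w else 0 :=
    Summable.of_nonneg_of_le (fun w => by split_ifs <;> [exact hS w; exact le_rfl])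
      (fun w => by split_ifs <;> [exact le_rfl; exact hS w]) hsum
  refine hs'.tsum_le_tsum (fun w => ?_) (summable_tailSum_term hS hsum _)
  by_cases hw : R ≤ Site.supNorm (w + y)
  · rw [if_pos hw, if_pos]
    have h1 : Site.supNorm (w + y) ≤ Site.supNorm w + Site.supNorm y := by
      have := Site.supNorm_le_supNorm_sub_add (w + y) y
      rwa [add_sub_cancel_right] at this
    omega
  · rw [if_neg hw]
    exact tailSum_term_nonneg hS _ w

/-- **The summed Simon–Lieb step.** If a non-negative summable `S` on `ℤ^d` satisfies, for every
`z ∉ S₀` (`S₀ ⊆ Λ_K` finite), `S(z) ≤ ∑_{x ∈ S₀} ∑_{y ∈ N(x)} c_x S(z - y)` with `c_x ≥ 0` and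
`‖y‖_∞ ≤ K + 1` for `y ∈ N(x)`, then its tails satisfy
`U_S(R) ≤ φ · U_S(R - (K+1))` for `R ≥ K + 1`, `φ = ∑_{x ∈ S₀} ∑_{y ∈ N(x)} c_x`
(Duminil-Copin–Tassion 2016, §2.5, summed over `z`). [folklore] -/
theorem tailSum_le_mul_tailSum (hS : ∀ x, 0 ≤ S x) (hsum : Summable S) {S₀ : Finset (Site d)}
    {K : ℕ} (hS₀ : S₀ ⊆ box d K) {N : Site d → Finset (Site d)} {c : Site d → ℝ}
    (hc : ∀ x ∈ S₀, 0 ≤ c x) (hN : ∀ x ∈ S₀, ∀ y ∈ N x, Site.supNorm y ≤ K + 1)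
    (hSL : ∀ z, z ∉ S₀ → S z ≤ ∑ x ∈ S₀, ∑ y ∈ N x, c x * S (z - y)) {R : ℕ} (hR : K + 1 ≤ R) :
    tailSum S R ≤ (∑ x ∈ S₀, ∑ _y ∈ N x, c x) * tailSum S (R - (K + 1)) := by
  -- pointwise bound of the tail term
  have hpt : ∀ z, (if R ≤ Site.supNorm z then S z else 0) ≤
      ∑ x ∈ S₀, ∑ y ∈ N x, c x * (if R ≤ Site.supNorm z then S (z - y) else 0) := by
    intro z
    by_cases hz : R ≤ Site.supNorm z
    · simp only [if_pos hz]
      refine hSL z fun hzS => ?_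
      have := mem_box_iff_supNorm_le.1 (hS₀ hzS)
      omega
    · simp only [if_neg hz, mul_zero, Finset.sum_const_zero]
      exact le_rfl
  have hsz : ∀ y, Summable fun z => if R ≤ Site.supNorm z then S (z - y) else 0 := by
    intro y
    have hsy : Summable fun z => S (z - y) := (Equiv.subRight y).summable_iff.2 hsum
    exact Summable.of_nonneg_of_le (fun z => by split_ifs <;> [exact hS _; exact le_rfl])
      (fun z => by split_ifs <;> [exact le_rfl; exact hS _]) hsy
  have hsrhs : Summable fun z => ∑ x ∈ S₀, ∑ y ∈ N x,
      c x * (if R ≤ Site.supNorm z then S (z - y) else 0) :=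
    summable_sum fun x _ => summable_sum fun y _ => (hsz y).mul_left _
  calc tailSum S R ≤ ∑' z, ∑ x ∈ S₀, ∑ y ∈ N x,
        c x * (if R ≤ Site.supNorm z then S (z - y) else 0) :=
        (summable_tailSum_term hS hsum R).tsum_le_tsum hpt hsrhs
    _ = ∑ x ∈ S₀, ∑ y ∈ N x, c x * ∑' z, (if R ≤ Site.supNorm z then S (z - y) else 0) := by
        rw [Summable.tsum_finsetSum (fun x _ => summable_sum fun y _ => (hsz y).mul_left _)]
        refine Finset.sum_congr rfl fun x _ => ?_
        rw [Summable.tsum_finsetSum (fun y _ => (hsz y).mul_left _)]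
        refine Finset.sum_congr rfl fun y _ => ?_
        exact tsum_mul_left
    _ ≤ ∑ x ∈ S₀, ∑ y ∈ N x, c x * tailSum S (R - (K + 1)) := by
        refine Finset.sum_le_sum fun x hx => Finset.sum_le_sum fun y hy => ?_
        exact mul_le_mul_of_nonneg_left (tsum_shift_tail_le hS hsum (hN x hx y hy)) (hc x hx)
    _ = (∑ x ∈ S₀, ∑ _y ∈ N x, c x) * tailSum S (R - (K + 1)) := by
        rw [Finset.sum_mul]
        refine Finset.sum_congr rfl fun x _ => ?_
        rw [Finset.sum_mul]

/-- Iterating the summed Simon–Lieb step: `U_S(j (K+1)) ≤ φ^j ∑_x S(x)`. [folklore] -/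
theorem tailSum_le_pow_mul_tsum (hS : ∀ x, 0 ≤ S x) (hsum : Summable S) {S₀ : Finset (Site d)}
    {K : ℕ} (hS₀ : S₀ ⊆ box d K) {N : Site d → Finset (Site d)} {c : Site d → ℝ}
    (hc : ∀ x ∈ S₀, 0 ≤ c x) (hN : ∀ x ∈ S₀, ∀ y ∈ N x, Site.supNorm y ≤ K + 1)
    (hSL : ∀ z, z ∉ S₀ → S z ≤ ∑ x ∈ S₀, ∑ y ∈ N x, c x * S (z - y)) (j : ℕ) :
    tailSum S (j * (K + 1)) ≤ (∑ x ∈ S₀, ∑ _y ∈ N x, c x) ^ j * ∑' x, S x := by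
  induction j with
  | zero => simp [tailSum_zero]
  | succ j ih =>
    have hφ0 : 0 ≤ ∑ x ∈ S₀, ∑ _y ∈ N x, c x :=
      Finset.sum_nonneg fun x hx => Finset.sum_nonneg fun _ _ => hc x hx
    have hstep := tailSum_le_mul_tailSum hS hsum hS₀ hc hN hSL (R := (j + 1) * (K + 1))
      (by nlinarith)
    have hsub : (j + 1) * (K + 1) - (K + 1) = j * (K + 1) := by
      rw [add_mul, one_mul, Nat.add_sub_cancel]
    rw [hsub] at hstep
    calc tailSum S ((j + 1) * (K + 1)) ≤ (∑ x ∈ S₀, ∑ _y ∈ N x, c x) * tailSum S (j * (K + 1)) :=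
          hstep
      _ ≤ (∑ x ∈ S₀, ∑ _y ∈ N x, c x) * ((∑ x ∈ S₀, ∑ _y ∈ N x, c x) ^ j * ∑' x, S x) :=
          mul_le_mul_of_nonneg_left ih hφ0
      _ = (∑ x ∈ S₀, ∑ _y ∈ N x, c x) ^ (j + 1) * ∑' x, S x := by ring

end Tails




section TwoPoint

/-- Translation invariance of pair correlations: `⟨σ_xσ_y⟩_μ = ⟨σ₀σ_{y-x}⟩_μ` for a
translation-invariant `μ`. [folklore] -/
theorem integral_spinAt_mul_spinAt_translate (μ : Measure (SpinConfig (Site d)))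
    (hμ : IsTranslationInvariantMeasure μ) (x y : Site d) :
    ∫ σ, spinAt x σ * spinAt y σ ∂μ = ∫ σ, spinAt 0 σ * spinAt (y - x) σ ∂μ := by
  have hpt : ∀ σ, spinAt x σ * spinAt y σ =
      spinAt 0 (configShift (-x) σ) * spinAt (y - x) (configShift (-x) σ) := fun σ => by
    simp [spinAt, configShift_apply]
  simp_rw [hpt]
  have hmeas : Measurable fun σ : SpinConfig (Site d) => spinAt 0 σ * spinAt (y - x) σ :=
    (measurable_spinAt 0).mul (measurable_spinAt _)
  calc ∫ σ, spinAt 0 (configShift (-x) σ) * spinAt (y - x) (configShift (-x) σ) ∂μ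
      = ∫ σ, spinAt 0 σ * spinAt (y - x) σ ∂(μ.map (configShift (-x))) :=
        (integral_map (configShift (-x)).measurable.aemeasurable hmeas.aestronglyMeasurable).symm
    _ = ∫ σ, spinAt 0 σ * spinAt (y - x) σ ∂μ := by rw [hμ (-x)]

/-- **The two-point function of the states `μ ∈ 𝒢(β, 0)`, `β ≤ β_c`, from the named facts**:
uniqueness (`hasUniqueGibbsMeasure_of_lt_criticalBeta`, `hasUniqueGibbsMeasure_criticalBeta`) and
the free state (`exists_freeMeasure`) identify every such `μ` with the translation-invariant
free state, so that `⟨σ_xσ_y⟩_μ = ⟨σ₀σ_{y-x}⟩^∅_{β,0}` (`twoPointFree`) (Friedli–Velenik 2017,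
Thm. 3.28, Exercise 3.16). [cite: FriedliVelenik2017, Thm. 3.28 and Exercise 3.16] -/
theorem isingGibbsMeasure_twoPoint_of_facts
    (hU₁ : ∀ {d : ℕ} {β : ℝ}, hasUniqueGibbsMeasure_of_lt_criticalBeta (d := d) (β := β))
    (hU₂ : ∀ {d : ℕ}, hasUniqueGibbsMeasure_criticalBeta (d := d))
    (hF : ∀ (d : ℕ) {β : ℝ}, exists_freeMeasure d (β := β) 0)
    (hd : 3 ≤ d) {β : ℝ} (hβ : 0 ≤ β) (hβc : β ≤ criticalBeta d)
    {μ : Measure (SpinConfig (Site d))} (hμ : μ ∈ isingGibbsMeasures d β 0) :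
    IsProbabilityMeasure μ ∧
      ∀ x y, ∫ σ, spinAt x σ * spinAt y σ ∂μ = twoPointFree d β (y - x) := by
  classical
  obtain ⟨μf, hμf, hTI, hcorr⟩ := hF d hβ le_rfl
  have huniq : HasUniqueGibbsMeasure (isingSpecification (zdGraph d) β 0) := by
    rcases hβc.lt_or_eq with hlt | heq
    · exact hU₁ (by omega) hβ hlt
    · rw [heq]
      exact hU₂ hd
  have hμeq : μ = μf := huniq.1 hμ hμf
  subst hμeq
  haveI : IsProbabilityMeasure μ := hμ.1
  refine ⟨hμ.1, fun x y => ?_⟩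
  rw [integral_spinAt_mul_spinAt_translate μ hTI x y]
  by_cases hv : y - x = 0
  · rw [hv, twoPointFree_zero]
    simp
  · have hpair : ∀ σ, spinAt 0 σ * spinAt (y - x) σ = spinProduct {0, y - x} σ := fun σ => by
      rw [spinProduct, Finset.prod_pair (Ne.symm hv)]
    simp_rw [hpair]
    change spinCorr μ {0, y - x} = _
    rw [hcorr, twoPointFree_eq_freeCorr β hv]

/-- A two-point function written as `⟨σ_xσ_y⟩_μ = S(y - x)` under a probability measure takes
values in `[-1, 1]`; in particular `S ≤ 1` and `S(0) = 1`. [folklore] -/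
theorem twoPointFn_le_one (μ : Measure (SpinConfig (Site d))) [IsProbabilityMeasure μ]
    {S : Site d → ℝ} (hS : ∀ x y, ∫ σ, spinAt x σ * spinAt y σ ∂μ = S (y - x)) (v : Site d) :
    S v ≤ 1 := by
  have h := hS 0 v
  rw [sub_zero] at h
  rw [← h]
  calc ∫ σ, spinAt 0 σ * spinAt v σ ∂μ ≤ ∫ _σ, (1 : ℝ) ∂μ := by
        refine integral_mono (integrable_spinAt_mul_spinAt μ 0 v) (integrable_const 1) fun σ => ?_
        calc spinAt 0 σ * spinAt v σ ≤ |spinAt 0 σ * spinAt v σ| := le_abs_self _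
          _ = 1 := by rw [abs_mul, abs_spinAt, abs_spinAt, mul_one]
    _ = 1 := by simp

/-- A two-point function `⟨σ_xσ_y⟩_μ = S(y - x)` under a probability measure has `S(0) = 1`
(`σ₀² = 1`). [folklore] -/
theorem twoPointFn_zero (μ : Measure (SpinConfig (Site d))) [IsProbabilityMeasure μ]
    {S : Site d → ℝ} (hS : ∀ x y, ∫ σ, spinAt x σ * spinAt y σ ∂μ = S (y - x)) : S 0 = 1 := by
  have h := hS 0 0
  rw [sub_zero] at h
  rw [← h]
  simp

end TwoPoint

section TreeBound

/-- Sums of shifts of a summable function: `∑_{a ∈ Λ} S(u - a) ≤ ∑_v S(v)` termwise in `u`,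
and `u ↦ ∑_{a ∈ Λ} S(u - a)` is summable with sum `|Λ| ∑_v S(v)`. [folklore] -/
theorem sum_shift_le_tsum {S : Site d → ℝ} (hS0 : ∀ v, 0 ≤ S v) (hsum : Summable S)
    (Λ : Finset (Site d)) (u : Site d) : ∑ a ∈ Λ, S (u - a) ≤ ∑' v, S v := by
  have hs : Summable fun a => S (u - a) := (Equiv.subLeft u).summable_iff.2 hsum
  calc ∑ a ∈ Λ, S (u - a) ≤ ∑' a, S (u - a) := hs.sum_le_tsum Λ fun a _ => hS0 _
    _ = ∑' v, S v := (Equiv.subLeft u).tsum_eq S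

/-- Shifts of summable functions on `ℤ^d` are summable. [folklore] -/
theorem summable_shift {S : Site d → ℝ} (hsum : Summable S) (a : Site d) :
    Summable fun u => S (u - a) := (Equiv.subRight a).summable_iff.2 hsum

/-- Shift invariance of sums over `ℤ^d`: `∑_u S(u - a) = ∑_v S(v)`. [folklore] -/
theorem tsum_shift {S : Site d → ℝ} (a : Site d) : ∑' u, S (u - a) = ∑' v, S v :=
  (Equiv.subRight a).tsum_eq S

/-- **Smearing the tree diagram bound over a box**: if `⟨σ_xσ_y⟩_μ = S(y-x)` with `S ≥ 0`
summable, the tree diagram bound gives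
`∑_{x ∈ Λ⁴} |U₄^μ(x)| ≤ 2 ∑_u (∑_{a ∈ Λ} S(u-a))⁴ ≤ 2 |Λ| (∑_v S(v))⁴`
(Aizenman 1982; the first display of the proof of Thm 5.5 of Panis 2023, p. 21, followed by
`∑_{a ∈ Λ} S(u - a) ≤ χ`). [cite: Panis2023Triviality, proof of Thm. 5.5, bound on (1) (p. 21)] -/
theorem sum_abs_connectedFour_le {μ : Measure (SpinConfig (Site d))} [IsProbabilityMeasure μ]
    (hT : ∀ x : Fin 4 → Site d,
      Summable (fun u : Site d => ∏ i, ∫ σ, spinAt (x i) σ * spinAt u σ ∂μ) →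
      |connectedFour μ spinAt x| ≤ 2 * ∑' u : Site d, ∏ i, ∫ σ, spinAt (x i) σ * spinAt u σ ∂μ)
    {S : Site d → ℝ} (hS : ∀ x y, ∫ σ, spinAt x σ * spinAt y σ ∂μ = S (y - x))
    (hS0 : ∀ v, 0 ≤ S v) (hsum : Summable S) (Λ : Finset (Site d)) :
    ∑ x ∈ Fintype.piFinset (fun _ : Fin 4 => Λ), |connectedFour μ spinAt x| ≤
      2 * #Λ * (∑' v, S v) ^ 4 := by
  set χ : ℝ := ∑' v, S v with hχ
  have hχ0 : 0 ≤ χ := tsum_nonneg hS0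
  have hS1 : ∀ v, S v ≤ 1 := twoPointFn_le_one μ hS
  set g : Site d → ℝ := fun u => ∑ a ∈ Λ, S (u - a) with hg
  have hg0 : ∀ u, 0 ≤ g u := fun u => Finset.sum_nonneg fun a _ => hS0 _
  have hgχ : ∀ u, g u ≤ χ := fun u => sum_shift_le_tsum hS0 hsum Λ u
  have hgsum : Summable g := summable_sum fun a _ => summable_shift hsum a
  have hgtsum : ∑' u, g u = #Λ * χ := by
    rw [hg, Summable.tsum_finsetSum (fun a _ => summable_shift hsum a)]
    simp_rw [tsum_shift, Finset.sum_const, nsmul_eq_mul, hχ]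
  -- pointwise tree bound, in terms of `S`
  have hterm : ∀ (x : Fin 4 → Site d) (u : Site d),
      ∏ i, ∫ σ, spinAt (x i) σ * spinAt u σ ∂μ = ∏ i, S (u - x i) := fun x u =>
    Finset.prod_congr rfl fun i _ => hS (x i) u
  have hsumx : ∀ x : Fin 4 → Site d, Summable fun u => ∏ i, S (u - x i) := by
    intro x
    refine Summable.of_nonneg_of_le (fun u => Finset.prod_nonneg fun i _ => hS0 _)
      (fun u => ?_) (summable_shift hsum (x 0))
    calc ∏ i, S (u - x i) = S (u - x 0) * ∏ i ∈ Finset.univ.erase 0, S (u - x i) :=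
          (Finset.mul_prod_erase _ _ (Finset.mem_univ 0)).symm
      _ ≤ S (u - x 0) * 1 := by
          refine mul_le_mul_of_nonneg_left ?_ (hS0 _)
          exact Finset.prod_le_one (fun i _ => hS0 _) fun i _ => hS1 _
      _ = S (u - x 0) := mul_one _
  have hU4 : ∀ x : Fin 4 → Site d, |connectedFour μ spinAt x| ≤ 2 * ∑' u, ∏ i, S (u - x i) := by
    intro x
    have h := hT x (by simp_rw [hterm x]; exact hsumx x)
    simp_rw [hterm x] at h
    exact h
  -- sum over the box and exchange
  have hswap : ∑ x ∈ Fintype.piFinset (fun _ : Fin 4 => Λ), ∑' u, ∏ i, S (u - x i) =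
      ∑' u, g u ^ 4 := by
    rw [← Summable.tsum_finsetSum (fun x _ => hsumx x)]
    refine tsum_congr fun u => ?_
    rw [hg]
    simp only
    rw [← Fin.prod_const 4 (∑ a ∈ Λ, S (u - a)), Finset.prod_univ_sum]
  have hg4 : ∀ u, g u ^ 4 ≤ χ ^ 3 * g u := fun u => by
    calc g u ^ 4 = g u ^ 3 * g u := by ring
      _ ≤ χ ^ 3 * g u :=
          mul_le_mul_of_nonneg_right (pow_le_pow_left₀ (hg0 u) (hgχ u) 3) (hg0 u)
  have hg4sum : Summable fun u => g u ^ 4 :=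
    Summable.of_nonneg_of_le (fun u => by positivity) hg4 (hgsum.mul_left _)
  calc ∑ x ∈ Fintype.piFinset (fun _ : Fin 4 => Λ), |connectedFour μ spinAt x|
      ≤ ∑ x ∈ Fintype.piFinset (fun _ : Fin 4 => Λ), 2 * ∑' u, ∏ i, S (u - x i) :=
        Finset.sum_le_sum fun x _ => hU4 x
    _ = 2 * ∑' u, g u ^ 4 := by rw [← Finset.mul_sum, hswap]
    _ ≤ 2 * (χ ^ 3 * ∑' u, g u) := by
        gcongr
        calc ∑' u, g u ^ 4 ≤ ∑' u, χ ^ 3 * g u := hg4sum.tsum_le_tsum hg4 (hgsum.mul_left _)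
          _ = χ ^ 3 * ∑' u, g u := tsum_mul_left
    _ = 2 * #Λ * χ ^ 4 := by rw [hgtsum]; ring

end TreeBound


section Boxes

/-- `Σ_L(μ) = ∑_{x, y ∈ Λ_L} ⟨σ_xσ_y⟩_μ`. [folklore] -/
theorem blockSpinVariance_eq_sum_sum (μ : Measure (SpinConfig (Site d))) [IsFiniteMeasure μ]
    (L : ℝ) : blockSpinVariance μ L =
      ∑ x ∈ latticeBox d L, ∑ y ∈ latticeBox d L, ∫ σ, spinAt x σ * spinAt y σ ∂μ := by
  have h : blockSpinVariance μ L = sqMoment μ (latticeBox d L) (fun _ => (1 : ℝ)) := by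
    unfold blockSpinVariance sqMoment spinSum
    simp only [one_mul]
  rw [h, sqMoment_eq_sum]
  simp only [one_mul]

/-- `Λ_L ⊆ Λ_{L'}` for `L ≤ L'`. [folklore] -/
theorem latticeBox_mono {L L' : ℝ} (h : L ≤ L') : latticeBox d L ⊆ latticeBox d L' := by
  intro x hx
  rw [mem_latticeBox] at hx ⊢
  exact fun i => (hx i).trans h

/-- Monotonicity of `Σ_L` in `L` when the two-point function is non-negative. [folklore] -/
theorem blockSpinVariance_mono (μ : Measure (SpinConfig (Site d))) [IsFiniteMeasure μ]
    (hG : ∀ x y, 0 ≤ ∫ σ, spinAt x σ * spinAt y σ ∂μ) {L L' : ℝ} (h : L ≤ L') :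
    blockSpinVariance μ L ≤ blockSpinVariance μ L' := by
  rw [blockSpinVariance_eq_sum_sum, blockSpinVariance_eq_sum_sum]
  calc ∑ x ∈ latticeBox d L, ∑ y ∈ latticeBox d L, ∫ σ, spinAt x σ * spinAt y σ ∂μ
      ≤ ∑ x ∈ latticeBox d L, ∑ y ∈ latticeBox d L', ∫ σ, spinAt x σ * spinAt y σ ∂μ :=
        Finset.sum_le_sum fun x _ =>
          Finset.sum_le_sum_of_subset_of_nonneg (latticeBox_mono h) fun y _ _ => hG x y
    _ ≤ ∑ x ∈ latticeBox d L', ∑ y ∈ latticeBox d L', ∫ σ, spinAt x σ * spinAt y σ ∂μ :=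
        Finset.sum_le_sum_of_subset_of_nonneg (latticeBox_mono h) fun x _ _ =>
          Finset.sum_nonneg fun y _ => hG x y

/-- **Lower bound on `Σ_L` by a truncated susceptibility**: if `Λ_L = Λ_n` and `2m ≤ n`, then
`Σ_L ≥ |Λ_m| ∑_{v ∈ Λ_m} S(v)` (for `x ∈ Λ_m`, `x + Λ_m ⊆ Λ_n`). [folklore] -/
theorem card_mul_sum_box_le_blockSpinVariance (μ : Measure (SpinConfig (Site d)))
    [IsFiniteMeasure μ] {S : Site d → ℝ}
    (hS : ∀ x y, ∫ σ, spinAt x σ * spinAt y σ ∂μ = S (y - x)) (hS0 : ∀ v, 0 ≤ S v)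
    {L : ℝ} {n m : ℕ} (hL : latticeBox d L = box d n) (hmn : 2 * m ≤ n) :
    (#(box d m) : ℝ) * ∑ v ∈ box d m, S v ≤ blockSpinVariance μ L := by
  rw [blockSpinVariance_eq_sum_sum, hL]
  simp_rw [hS]
  have hsub : box d m ⊆ box d n := box_mono d (by omega)
  calc (#(box d m) : ℝ) * ∑ v ∈ box d m, S v = ∑ x ∈ box d m, ∑ v ∈ box d m, S v := by
        rw [Finset.sum_const, nsmul_eq_mul]
    _ = ∑ x ∈ box d m, ∑ y ∈ (box d m).image (· + x), S (y - x) := by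
        refine Finset.sum_congr rfl fun x _ => ?_
        rw [Finset.sum_image fun a _ b _ h => add_right_cancel h]
        simp
    _ ≤ ∑ x ∈ box d m, ∑ y ∈ box d n, S (y - x) := by
        refine Finset.sum_le_sum fun x hx => Finset.sum_le_sum_of_subset_of_nonneg ?_
          fun y _ _ => hS0 _
        intro y hy
        obtain ⟨a, ha, rfl⟩ := Finset.mem_image.1 hy
        rw [mem_box] at ha hx ⊢
        intro i
        have h1 := ha i
        have h2 := hx i
        simp only [Pi.add_apply]
        constructor <;> omega
    _ ≤ ∑ x ∈ box d n, ∑ y ∈ box d n, S (y - x) :=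
        Finset.sum_le_sum_of_subset_of_nonneg hsub fun x _ _ =>
          Finset.sum_nonneg fun y _ => hS0 _

/-- `|Λ_{rL}| ≤ (3 r L)^d` for `r L ≥ 1`. [folklore] -/
theorem card_latticeBox_le {t : ℝ} (ht : 1 ≤ t) : (#(latticeBox d t) : ℝ) ≤ (3 * t) ^ d := by
  rw [latticeBox_eq_box (zero_le_one.trans ht), card_box]
  push_cast
  have h1 : ((⌊t⌋₊ : ℕ) : ℝ) ≤ t := Nat.floor_le (zero_le_one.trans ht)
  have h2 : (2 * (⌊t⌋₊ : ℝ) + 1) ≤ 3 * t := by linarith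
  exact pow_le_pow_left₀ (by positivity) h2 d

/-- `|Λ_{⌊n/2⌋}| ≥ n^d`. [folklore] -/
theorem pow_le_card_box_half (n : ℕ) : (n : ℝ) ^ d ≤ #(box d (n / 2)) := by
  rw [card_box]
  push_cast
  have h : (n : ℝ) ≤ 2 * ((n / 2 : ℕ) : ℝ) + 1 := by
    have := Nat.lt_div_mul_add (a := n) (b := 2) two_pos
    have h' : (n : ℝ) < ((n / 2 : ℕ) : ℝ) * 2 + 2 := by exact_mod_cast this
    have h'' : n ≤ 2 * (n / 2) + 1 := by omega
    exact_mod_cast h''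
  exact pow_le_pow_left₀ (Nat.cast_nonneg n) h d

/-- `L^d ≤ |Λ_L|` for `L ≥ 1` (indeed `2⌊L⌋ + 1 ≥ L`). [folklore] -/
theorem pow_le_card_latticeBox {L : ℝ} (hL : 1 ≤ L) : L ^ d ≤ #(latticeBox d L) := by
  rw [latticeBox_eq_box (zero_le_one.trans hL), card_box]
  push_cast
  have h1 : L < (⌊L⌋₊ : ℝ) + 1 := Nat.lt_floor_add_one L
  have h2 : L ≤ 2 * (⌊L⌋₊ : ℝ) + 1 := by
    have : (1 : ℝ) ≤ ⌊L⌋₊ := by exact_mod_cast Nat.one_le_iff_ne_zero.2 (Nat.floor_pos.2 hL).ne'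
    linarith
  exact pow_le_pow_left₀ (zero_le_one.trans hL) h2 d

end Boxes

section Infrared

/-- `∂Λ_0 = {0}`. [folklore] -/
theorem sphere_zero : sphere d 0 = {0} := by
  ext v
  rw [mem_sphere, Finset.mem_singleton, Site.supNorm_eq_zero_iff]

/-- **The truncated susceptibility in `d = 4` grows at most quadratically** (the infrared bound
at `β_c` in `x`-space, `⟨σ₀σ_x⟩^f_{β_c} ≤ C ‖x‖^{-2}`, a theorem of the tree
(`twoPointFree_criticalBeta_upper_holds`), Griffiths' monotonicity in `β`, and a shell count:
`χ_n(β) = ∑_{x ∈ Λ_n} ⟨σ₀σ_x⟩^f_β ≤ C' (n+1)²` for all `0 ≤ β ≤ β_c`; Aizenman–Duminil-Copin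
2021, §6.3, "`χ_L(β) ≤ C₆ L²`"). [cite: AizenmanDuminilCopinAnnals2021, arXiv:1912.07973 §6.3, bound χ_L(β) ≤ C₆L² (p. 26)] -/
theorem exists_sum_box_twoPointFree_le_sq :
    ∃ C : ℝ, 0 < C ∧ ∀ β : ℝ, 0 ≤ β → β ≤ criticalBeta 4 → ∀ n : ℕ,
      ∑ v ∈ box 4 n, twoPointFree 4 β v ≤ C * ((n : ℝ) + 1) ^ 2 := by
  obtain ⟨C₀, hC₀⟩ := twoPointFree_criticalBeta_upper_holds (d := 4) (by norm_num)
  have hlim : hasBoxLimit_isingCorr_free 4 := hasBoxLimit_isingCorr_free_holds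
  have hβmono : isingCorr_free_mono_beta (d := 4) := isingCorr_free_mono_beta_of_gks_two
    fun _ _ _ _ _ _ => GKSInequalities.gks_two_holds (zdGraph 4)
  refine ⟨1 + 216 * |C₀|, by positivity, fun β hβ hβc n => ?_⟩
  -- shell bound for `m = k + 1 ≥ 1`
  have hshell : ∀ k : ℕ, ∑ v ∈ sphere 4 (k + 1), twoPointFree 4 β v ≤ 216 * |C₀| * (k + 1) := by
    intro k
    have hpt : ∀ v ∈ sphere 4 (k + 1), twoPointFree 4 β v ≤ |C₀| / ((k : ℝ) + 1) ^ 2 := by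
      intro v hv
      have hvn : Site.supNorm v = k + 1 := mem_sphere.1 hv
      have hv0 : v ≠ 0 := fun h => by rw [h, Site.supNorm_eq_zero_iff.2 rfl] at hvn; omega
      have hnorm : (‖v‖ : ℝ) = (k : ℝ) + 1 := by
        rw [Site.norm_eq_supNorm, hvn]; push_cast; ring
      have hexp : (‖v‖ : ℝ) ^ (-(((4 : ℕ) : ℝ) - 2)) = (((k : ℝ) + 1) ^ 2)⁻¹ := by
        rw [hnorm, show (-(((4 : ℕ) : ℝ) - 2)) = -(2 : ℝ) by norm_num,
          Real.rpow_neg (by positivity), Real.rpow_two]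
      calc twoPointFree 4 β v ≤ twoPointFree 4 (criticalBeta 4) v :=
            twoPointFree_mono_beta hβmono hlim hβ hβc v
        _ ≤ C₀ * (‖v‖ : ℝ) ^ (-(((4 : ℕ) : ℝ) - 2)) := hC₀ v hv0
        _ = C₀ / ((k : ℝ) + 1) ^ 2 := by rw [hexp, div_eq_mul_inv]
        _ ≤ |C₀| / ((k : ℝ) + 1) ^ 2 := by
            gcongr
            exact le_abs_self C₀
    calc ∑ v ∈ sphere 4 (k + 1), twoPointFree 4 β v
        ≤ ∑ v ∈ sphere 4 (k + 1), |C₀| / ((k : ℝ) + 1) ^ 2 := Finset.sum_le_sum hpt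
      _ = (#(sphere 4 (k + 1)) : ℝ) * (|C₀| / ((k : ℝ) + 1) ^ 2) := by
          rw [Finset.sum_const, nsmul_eq_mul]
      _ ≤ (2 * (4 : ℕ) * (2 * k + 3 : ℝ) ^ (4 - 1)) * (|C₀| / ((k : ℝ) + 1) ^ 2) := by
          gcongr
          exact card_sphere_succ_le k
      _ ≤ (8 * (3 * ((k : ℝ) + 1)) ^ 3) * (|C₀| / ((k : ℝ) + 1) ^ 2) := by
          gcongr
          · norm_num
          · linarith
      _ = 216 * |C₀| * (k + 1) := by
          field_simp
          ring
  rw [sum_box_eq_sum_sphere, Finset.sum_range_succ', sphere_zero, Finset.sum_singleton,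
    twoPointFree_zero]
  calc ∑ k ∈ Finset.range n, ∑ v ∈ sphere 4 (k + 1), twoPointFree 4 β v + 1
      ≤ ∑ k ∈ Finset.range n, 216 * |C₀| * ((n : ℝ) + 1) + 1 := by
        gcongr with k hk
        refine (hshell k).trans ?_
        gcongr
        exact_mod_cast (Finset.mem_range.1 hk).le
    _ = n * (216 * |C₀| * ((n : ℝ) + 1)) + 1 := by rw [Finset.sum_const, Finset.card_range, nsmul_eq_mul]
    _ ≤ (1 + 216 * |C₀|) * ((n : ℝ) + 1) ^ 2 := by
        have hn : (0 : ℝ) ≤ n := Nat.cast_nonneg n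
        have hC : 0 ≤ |C₀| := abs_nonneg _
        nlinarith

end Infrared


section Regimes

/-- **A high-temperature scale**: there is `β₀ > 0` with `φ_{β₀}({0}) = 2d tanh β₀ < 1/2`
(Duminil-Copin–Tassion's criterion for the one-point set). [folklore] -/
theorem exists_beta_dctIsingPhi_singleton_lt : ∃ β₀ : ℝ, 0 < β₀ ∧ dctIsingPhi d β₀ {0} < 1 / 2 := by
  classical
  set N : ℕ := #(((zdGraph d).neighborFinset 0).filter (fun y => y ∉ ({0} : Finset (Site d))))
    with hN
  have hφ : ∀ β : ℝ, dctIsingPhi d β {0} = N * Real.tanh β := by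
    intro β
    rw [dctIsingPhi_def, Finset.sum_singleton, Finset.sum_const, nsmul_eq_mul, isingTwoPoint_self,
      mul_one]
  have htanh : Continuous Real.tanh := by
    have h : Real.tanh = fun x => Real.sinh x / Real.cosh x := funext Real.tanh_eq_sinh_div_cosh
    rw [h]
    exact Real.continuous_sinh.div Real.continuous_cosh fun x => (Real.cosh_pos x).ne'
  have hcont : ContinuousAt (fun β => (N : ℝ) * Real.tanh β) 0 :=
    (continuous_const.mul htanh).continuousAt
  have hlt : (N : ℝ) * Real.tanh 0 < 1 / 2 := by rw [Real.tanh_zero, mul_zero]; norm_num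
  have hev := hcont.eventually (gt_mem_nhds hlt)
  obtain ⟨ε, hε, hball⟩ := Metric.eventually_nhds_iff.1 hev
  refine ⟨ε / 2, by positivity, ?_⟩
  rw [hφ]
  exact hball (by rw [Real.dist_eq, sub_zero, abs_of_pos (by positivity)]; linarith)

/-- **Saturation of the susceptibility from a set with `φ_β(S₀) < 1/2`** (the modified
Simon–Lieb inequality summed over the tail, Duminil-Copin–Tassion 2016 §2.5; cf. Panis 2023,
Remark 3.22, `χ ≤ |S|/(1 - φ_β(S))`): for the free state at `β > 0`, if `0 ∈ S₀ ⊆ Λ_K` and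
`φ_β(S₀) < 1/2`, then `x ↦ ⟨σ₀σ_x⟩^∅_β` is summable, `χ(β) ≤ 2 χ_K(β)`, and
`χ_m(β) ≥ χ(β)/2` for every `m ≥ K` (`χ_m = ∑_{x ∈ Λ_m} ⟨σ₀σ_x⟩^∅_β`). [cite: Panis2023Triviality, Rem. 3.22] -/
theorem susceptibility_saturation {β : ℝ} (hβ : 0 < β) {S₀ : Finset (Site d)}
    (h0 : (0 : Site d) ∈ S₀) {K : ℕ} (hSK : S₀ ⊆ box d K) (hφ : dctIsingPhi d β S₀ < 1 / 2) :
    Summable (twoPointFree d β) ∧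
      (∑' v, twoPointFree d β v) ≤ 2 * ∑ v ∈ box d K, twoPointFree d β v ∧
      ∀ m : ℕ, K ≤ m → (∑' v, twoPointFree d β v) ≤ 2 * ∑ v ∈ box d m, twoPointFree d β v := by
  have hgks : ∀ {Λ A : Finset (Site d)} {β h : ℝ} {bc : BoundaryCondition (Site d)},
      gks_one (zdGraph d) (Λ := Λ) (A := A) (β := β) (h := h) (bc := bc) :=
    GKSInequalities.gks_one_holds (zdGraph d)
  have hgks2 : ∀ (G' : SimpleGraph (Site d)) [G'.LocallyFinite] (Λ A B : Finset (Site d))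
      (β h : ℝ) (bc : BoundaryCondition (Site d)),
      gks_two G' (Λ := Λ) (A := A) (B := B) (β := β) (h := h) (bc := bc) :=
    fun G' _ _ _ _ _ _ _ => GKSInequalities.gks_two_holds G'
  have hlim : hasBoxLimit_isingCorr_free d := hasBoxLimit_isingCorr_free_holds
  have hmono : isingCorr_free_mono_volume (d := d) := isingCorr_free_mono_volume_of_gks_two hgks2
  have hMS : dct_modifiedSimon_finiteVolume (d := d) := dct_modifiedSimon_finiteVolume_holds
  have htr : isingTwoPoint_free_translate (d := d) := isingTwoPoint_free_translate_holds
  set S : Site d → ℝ := twoPointFree d β with hSdef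
  have hS0 : ∀ v, 0 ≤ S v := fun v => twoPointFree_nonneg hlim hgks hβ.le v
  -- summability from exponential decay
  obtain ⟨c, hc, hdecay⟩ := twoPointFree_exp_decay_of_dctIsingPhi_lt_one hMS htr hgks hlim hmono
    hβ h0 (hφ.trans (by norm_num))
  have hsum : Summable S :=
    summable_of_exp_decay hS0 hc (C := 1) fun x => by rw [one_mul]; exact hdecay x
  -- the summed Simon–Lieb iteration with `j = 1`
  set N : Site d → Finset (Site d) := fun x => ((zdGraph d).neighborFinset x).filter (fun y => y ∉ S₀)
  set cf : Site d → ℝ := fun x => Real.tanh β * isingTwoPoint (zdGraph d) S₀ β 0 .free 0 x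
  have hcf : ∀ x ∈ S₀, 0 ≤ cf x := fun x hx =>
    mul_nonneg (tanh_nonneg hβ.le) (isingTwoPoint_free_nonneg hgks hβ.le h0 hx)
  have hNK : ∀ x ∈ S₀, ∀ y ∈ N x, Site.supNorm y ≤ K + 1 := by
    intro x hx y hy
    have hadj : (zdGraph d).Adj x y :=
      (SimpleGraph.mem_neighborFinset _ _ _).1 (Finset.mem_filter.1 hy).1
    have hxK := mem_box_iff_supNorm_le.1 (hSK hx)
    exact (Site.supNorm_le_succ_of_adj hadj).trans (by omega)
  have hSL : ∀ z, z ∉ S₀ → S z ≤ ∑ x ∈ S₀, ∑ y ∈ N x, cf x * S (z - y) := fun z hz =>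
    twoPointFree_le_dct_sum hMS hgks hmono hlim htr hβ h0 hz
  have hφeq : (∑ x ∈ S₀, ∑ _y ∈ N x, cf x) = dctIsingPhi d β S₀ := by rw [dctIsingPhi_def]
  have hiter := tailSum_le_pow_mul_tsum hS0 hsum hSK hcf hNK hSL 1
  rw [hφeq, pow_one, one_mul] at hiter
  -- `U(K+1) ≤ χ/2`
  set χ : ℝ := ∑' v, S v with hχ
  have hχ0 : 0 ≤ χ := tsum_nonneg hS0
  have htail : tailSum S (K + 1) ≤ χ / 2 := by
    calc tailSum S (K + 1) ≤ dctIsingPhi d β S₀ * χ := hiter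
      _ ≤ (1 / 2) * χ := mul_le_mul_of_nonneg_right hφ.le hχ0
      _ = χ / 2 := by ring
  have hkey : ∀ m : ℕ, K ≤ m → χ ≤ 2 * ∑ v ∈ box d m, S v := by
    intro m hm
    have hsplit := sum_box_add_tailSum hsum m
    have hmono' : tailSum S (m + 1) ≤ tailSum S (K + 1) := tailSum_antitone hS0 hsum (by omega)
    rw [← hχ] at hsplit
    linarith
  exact ⟨hsum, hkey K le_rfl, hkey⟩

/-- **The plain tree-diagram-bound estimate of `S(μ; L, r)`.** If `⟨σ_xσ_y⟩_μ = S(y - x)` with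
`S ≥ 0` summable, then for `L ≥ 2`, `r ≥ 1`,
`S(μ; L, r) ≤ 2 · 12^d r^d χ⁴ / (L^d χ_{⌊L⌋/2}²)`, where `χ = ∑_v S(v)` and
`χ_m = ∑_{v ∈ Λ_m} S(v)` (numerator: `sum_abs_connectedFour_le` with `|Λ_{rL}| ≤ (3rL)^d`;
denominator: `Σ_L ≥ |Λ_{⌊L⌋/2}| χ_{⌊L⌋/2} ≥ (L/2)^d χ_{⌊L⌋/2}`) (Aizenman 1982; Panis 2023,
proof of Thm 5.5, bound on (1), p. 21). [cite: Panis2023Triviality, proof of Thm. 5.5, bound on (1) (p. 21)] -/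
theorem ursellFourSum_le_of_summable {μ : Measure (SpinConfig (Site d))}
    [IsProbabilityMeasure μ]
    (hT : ∀ x : Fin 4 → Site d,
      Summable (fun u : Site d => ∏ i, ∫ σ, spinAt (x i) σ * spinAt u σ ∂μ) →
      |connectedFour μ spinAt x| ≤ 2 * ∑' u : Site d, ∏ i, ∫ σ, spinAt (x i) σ * spinAt u σ ∂μ)
    {S : Site d → ℝ} (hS : ∀ x y, ∫ σ, spinAt x σ * spinAt y σ ∂μ = S (y - x))
    (hS0 : ∀ v, 0 ≤ S v) (hsum : Summable S) {L r : ℝ} (hL : 2 ≤ L) (hr : 1 ≤ r) :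
    ursellFourSum μ L r ≤ 2 * 12 ^ d * r ^ d * (∑' v, S v) ^ 4 /
      (L ^ d * (∑ v ∈ box d (⌊L⌋₊ / 2), S v) ^ 2) := by
  set χ : ℝ := ∑' v, S v with hχ
  set n : ℕ := ⌊L⌋₊ with hn
  set B : ℝ := ∑ v ∈ box d (n / 2), S v with hB
  have hL0 : 0 ≤ L := by linarith
  have hL1 : 1 ≤ L := by linarith
  have hLn : latticeBox d L = box d n := latticeBox_eq_box hL0
  have hB1 : 1 ≤ B := by
    have h0mem : (0 : Site d) ∈ box d (n / 2) := zero_mem_box d _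
    calc (1 : ℝ) = S 0 := (twoPointFn_zero μ hS).symm
      _ ≤ B := Finset.single_le_sum (fun v _ => hS0 v) h0mem
  have hB0 : 0 < B := one_pos.trans_le hB1
  -- numerator
  have hnum : ∑ x ∈ Fintype.piFinset (fun _ : Fin 4 => latticeBox d (r * L)),
      |connectedFour μ spinAt x| ≤ 2 * (3 * (r * L)) ^ d * χ ^ 4 := by
    have h := sum_abs_connectedFour_le hT hS hS0 hsum (latticeBox d (r * L))
    refine h.trans ?_
    have hrL : 1 ≤ r * L := by nlinarith
    have hcard := card_latticeBox_le (d := d) hrL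
    have hχ0 : 0 ≤ χ := tsum_nonneg hS0
    gcongr
  -- denominator
  have hden : (L / 2) ^ d * B ≤ blockSpinVariance μ L := by
    have h1 := card_mul_sum_box_le_blockSpinVariance μ hS hS0 hLn (m := n / 2)
      (Nat.mul_div_le n 2)
    refine le_trans ?_ h1
    refine mul_le_mul_of_nonneg_right ?_ hB0.le
    refine le_trans ?_ (pow_le_card_box_half n)
    refine pow_le_pow_left₀ (by positivity) ?_ d
    have : L < (n : ℝ) + 1 := Nat.lt_floor_add_one L
    linarith
  have hSpos : 0 < blockSpinVariance μ L := lt_of_lt_of_le (by positivity) hden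
  -- combine
  rw [ursellFourSum]
  rw [div_le_div_iff₀ (pow_pos hSpos 2) (by positivity)]
  calc (∑ x ∈ Fintype.piFinset (fun _ : Fin 4 => latticeBox d (r * L)), |connectedFour μ spinAt x|) *
        (L ^ d * B ^ 2)
      ≤ (2 * (3 * (r * L)) ^ d * χ ^ 4) * (L ^ d * B ^ 2) :=
        mul_le_mul_of_nonneg_right hnum (by positivity)
    _ = 2 * 12 ^ d * r ^ d * χ ^ 4 * ((L / 2) ^ d * B) ^ 2 := by
        rw [show (12 : ℝ) = 3 * 2 * 2 by norm_num]
        rw [mul_pow, mul_pow, mul_pow, mul_pow, div_pow]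
        field_simp
    _ ≤ 2 * 12 ^ d * r ^ d * χ ^ 4 * blockSpinVariance μ L ^ 2 := by
        have hχ0 : 0 ≤ χ := tsum_nonneg hS0
        gcongr

/-- **Dilation**: `S(μ; L, r) ≤ S(μ; L/M, M r)` for `M ≥ 1` (same box `Λ_{rL}`, and
`Σ_{L/M} ≤ Σ_L` by Griffiths' first inequality). [folklore] -/
theorem ursellFourSum_le_dilate (μ : Measure (SpinConfig (Site d))) [IsFiniteMeasure μ]
    (hG : ∀ x y, 0 ≤ ∫ σ, spinAt x σ * spinAt y σ ∂μ) {L M r : ℝ} (hM : 1 ≤ M) (hL : 0 ≤ L)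
    (hpos : 0 < blockSpinVariance μ (L / M)) :
    ursellFourSum μ L r ≤ ursellFourSum μ (L / M) (M * r) := by
  have hM0 : M ≠ 0 := by positivity
  have hbox : latticeBox d (M * r * (L / M)) = latticeBox d (r * L) := by
    congr 1
    field_simp
  rw [ursellFourSum, ursellFourSum, hbox]
  have hle : blockSpinVariance μ (L / M) ≤ blockSpinVariance μ L :=
    blockSpinVariance_mono μ hG (div_le_self hL hM)
  have hA : 0 ≤ ∑ x ∈ Fintype.piFinset (fun _ : Fin 4 => latticeBox d (r * L)),
      |connectedFour μ spinAt x| := Finset.sum_nonneg fun x _ => abs_nonneg _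
  exact div_le_div_of_nonneg_left hA (pow_pos hpos 2) (pow_le_pow_left₀ hpos.le hle 2)

end Regimes


section SmallBeta

/-- `∑_{v ∈ Λ_0} S(v) = S(0)`. [folklore] -/
theorem sum_box_zero (S : Site d → ℝ) : ∑ v ∈ box d 0, S v = S 0 := by
  rw [sum_box_eq_sum_sphere, Finset.sum_range_one, sphere_zero, Finset.sum_singleton]

/-- **High temperature** (`0 ≤ β ≤ β₀` with `φ_{β₀}({0}) < 1/2`): the susceptibility is at
most `2`, whence `S(μ; L, r) ≤ 32 · 12^d r^d / L^d` for `L ≥ 2`, `r ≥ 1`, by the plain tree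
diagram bound (Aizenman 1982) and `Σ_L ≥ (L/2)^d` (the white-noise regime of Panis 2023,
§1.2.1, fn. 2, quantified). [cite: Panis2023Triviality, §1.2.1 fn. 2] -/
theorem ursellFourSum_le_of_le_smallBeta
    (hU₁ : ∀ {d : ℕ} {β : ℝ}, hasUniqueGibbsMeasure_of_lt_criticalBeta (d := d) (β := β))
    (hU₂ : ∀ {d : ℕ}, hasUniqueGibbsMeasure_criticalBeta (d := d))
    (hF : ∀ (d : ℕ) {β : ℝ}, exists_freeMeasure d (β := β) 0)
    (hd : 3 ≤ d) {β₀ : ℝ} (hβ₀ : 0 < β₀) (hφ₀ : dctIsingPhi d β₀ {0} < 1 / 2)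
    {β : ℝ} (hβ : 0 ≤ β) (hββ₀ : β ≤ β₀) (hβc : β ≤ criticalBeta d)
    {μ : Measure (SpinConfig (Site d))} (hμ : μ ∈ isingGibbsMeasures d β 0)
    (hT : ∀ x : Fin 4 → Site d,
      Summable (fun u : Site d => ∏ i, ∫ σ, spinAt (x i) σ * spinAt u σ ∂μ) →
      |connectedFour μ spinAt x| ≤ 2 * ∑' u : Site d, ∏ i, ∫ σ, spinAt (x i) σ * spinAt u σ ∂μ)
    {L r : ℝ} (hL : 2 ≤ L) (hr : 1 ≤ r) :
    ursellFourSum μ L r ≤ 32 * 12 ^ d * r ^ d / L ^ d := by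
  have hlim : hasBoxLimit_isingCorr_free d := hasBoxLimit_isingCorr_free_holds
  have hgks : ∀ {Λ A : Finset (Site d)} {β h : ℝ} {bc : BoundaryCondition (Site d)},
      gks_one (zdGraph d) (Λ := Λ) (A := A) (β := β) (h := h) (bc := bc) :=
    GKSInequalities.gks_one_holds (zdGraph d)
  have hβmono : isingCorr_free_mono_beta (d := d) := isingCorr_free_mono_beta_of_gks_two
    fun _ _ _ _ _ _ => GKSInequalities.gks_two_holds (zdGraph d)
  -- the state and its two-point function
  obtain ⟨hP, hS⟩ := isingGibbsMeasure_twoPoint_of_facts hU₁ hU₂ hF hd hβ hβc hμ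
  haveI := hP
  set S : Site d → ℝ := twoPointFree d β with hSdef
  have hS0 : ∀ v, 0 ≤ S v := fun v => twoPointFree_nonneg hlim hgks hβ v
  -- comparison with `β₀`, where the susceptibility is at most `2`
  obtain ⟨hsum₀, hχ₀, -⟩ := susceptibility_saturation hβ₀ (S₀ := {0}) (Finset.mem_singleton_self 0)
    (K := 0) (by intro x hx; rw [Finset.mem_singleton.1 hx]; exact zero_mem_box d 0) hφ₀
  rw [sum_box_zero, twoPointFree_zero, mul_one] at hχ₀
  have hle₀ : ∀ v, S v ≤ twoPointFree d β₀ v := fun v => twoPointFree_mono_beta hβmono hlim hβ hββ₀ v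
  have hsum : Summable S := Summable.of_nonneg_of_le hS0 hle₀ hsum₀
  have hχ2 : (∑' v, S v) ≤ 2 := (hsum.tsum_le_tsum hle₀ hsum₀).trans hχ₀
  have hχ0 : 0 ≤ ∑' v, S v := tsum_nonneg hS0
  -- the tree-diagram estimate
  have key := ursellFourSum_le_of_summable hT hS hS0 hsum hL hr
  have hB1 : 1 ≤ ∑ v ∈ box d (⌊L⌋₊ / 2), S v := by
    calc (1 : ℝ) = S 0 := (twoPointFn_zero μ hS).symm
      _ ≤ _ := Finset.single_le_sum (fun v _ => hS0 v) (zero_mem_box d _)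
  have hL0 : 0 < L := by linarith
  refine key.trans ?_
  rw [div_le_div_iff₀ (by positivity) (by positivity)]
  calc 2 * 12 ^ d * r ^ d * (∑' v, S v) ^ 4 * L ^ d
      ≤ 2 * 12 ^ d * r ^ d * 2 ^ 4 * L ^ d := by gcongr
    _ = 32 * 12 ^ d * r ^ d * (L ^ d * 1 ^ 2) := by ring
    _ ≤ 32 * 12 ^ d * r ^ d * (L ^ d * (∑ v ∈ box d (⌊L⌋₊ / 2), S v) ^ 2) := by gcongr

end SmallBeta

section OffWindow

/-- **Off the sharp-length window in `d = 4`.** If at scale `L/M` (`M ≥ 64`, `L ≥ 4M`) some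
finite `S₀ ∋ 0` inside `Λ_{16 L/M}` has `φ_β(S₀) < 1/2`, then the susceptibility saturates
within `Λ_{⌊16L/M⌋}` and beyond: `χ ≤ 2 χ_K ≤ 2 C₁ (K+1)²` (infrared bound) and
`χ_{⌊L⌋/2} ≥ χ/2`, so the plain tree diagram bound gives
`S(μ; L, r) ≤ 32 · 12⁴ · 17⁴ C₁² r⁴ / M⁴` (Aizenman 1982; Duminil-Copin–Tassion 2016 §2.5;
the regime complementary to Panis 2023, Cor. 1.8). [cite: Panis2023Triviality, §1.2.1 fn. 2 and Rem. 3.22] -/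
theorem ursellFourSum_le_offWindow
    (hU₁ : ∀ {d : ℕ} {β : ℝ}, hasUniqueGibbsMeasure_of_lt_criticalBeta (d := d) (β := β))
    (hU₂ : ∀ {d : ℕ}, hasUniqueGibbsMeasure_criticalBeta (d := d))
    (hF : ∀ (d : ℕ) {β : ℝ}, exists_freeMeasure d (β := β) 0)
    {C₁ : ℝ} (hC₁0 : 0 < C₁)
    (hC₁ : ∀ β : ℝ, 0 ≤ β → β ≤ criticalBeta 4 → ∀ n : ℕ,
      ∑ v ∈ box 4 n, twoPointFree 4 β v ≤ C₁ * ((n : ℝ) + 1) ^ 2)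
    {β : ℝ} (hβ : 0 < β) (hβc : β ≤ criticalBeta 4)
    {μ : Measure (SpinConfig (Site 4))} (hμ : μ ∈ isingGibbsMeasures 4 β 0)
    (hT : ∀ x : Fin 4 → Site 4,
      Summable (fun u : Site 4 => ∏ i, ∫ σ, spinAt (x i) σ * spinAt u σ ∂μ) →
      |connectedFour μ spinAt x| ≤ 2 * ∑' u : Site 4, ∏ i, ∫ σ, spinAt (x i) σ * spinAt u σ ∂μ)
    {L M r : ℝ} (hM : 64 ≤ M) (hLM : 4 * M ≤ L) (hr : 1 ≤ r)
    {S₀ : Finset (Site 4)} (h0 : (0 : Site 4) ∈ S₀) (hS₀ : S₀ ⊆ latticeBox 4 (16 * (L / M)))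
    (hφ : dctIsingPhi 4 β S₀ < 1 / 2) :
    ursellFourSum μ L r ≤ 32 * 12 ^ 4 * 17 ^ 4 * C₁ ^ 2 * r ^ 4 / M ^ 4 := by
  have hM0 : 0 < M := by linarith
  have hL4 : 4 ≤ L := by nlinarith
  have hL2 : 2 ≤ L := by linarith
  have hLM1 : 1 ≤ L / M := by rw [le_div_iff₀ hM0]; linarith
  have hLM0 : 0 ≤ 16 * (L / M) := by positivity
  -- the state and its two-point function
  obtain ⟨hP, hS⟩ := isingGibbsMeasure_twoPoint_of_facts hU₁ hU₂ hF (by norm_num) hβ.le hβc hμ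
  haveI := hP
  set S : Site 4 → ℝ := twoPointFree 4 β with hSdef
  set K : ℕ := ⌊16 * (L / M)⌋₊ with hK
  have hSK : S₀ ⊆ box 4 K := by rwa [latticeBox_eq_box hLM0] at hS₀
  obtain ⟨hsum, hχK, hχm⟩ := susceptibility_saturation hβ h0 hSK hφ
  have hS0 : ∀ v, 0 ≤ S v := fun v =>
    twoPointFree_nonneg hasBoxLimit_isingCorr_free_holds (GKSInequalities.gks_one_holds (zdGraph 4))
      hβ.le v
  set χ : ℝ := ∑' v, S v with hχ
  -- `χ ≤ 2 C₁ (K+1)²`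
  have hχle : χ ≤ 2 * (C₁ * ((K : ℝ) + 1) ^ 2) :=
    hχK.trans (mul_le_mul_of_nonneg_left (hC₁ β hβ.le hβc K) zero_le_two)
  -- `K ≤ ⌊L⌋/2`, so `χ_{⌊L⌋/2} ≥ χ/2`
  have hKreal : (K : ℝ) ≤ 16 * (L / M) := Nat.floor_le hLM0
  have h16 : 16 * (L / M) ≤ L / 4 := by
    rw [mul_div_assoc', div_le_div_iff₀ hM0 (by norm_num : (0 : ℝ) < 4)]
    nlinarith
  have hKn : K ≤ ⌊L⌋₊ / 2 := by
    rw [Nat.le_div_iff_mul_le two_pos]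
    have h1 : ((K * 2 : ℕ) : ℝ) ≤ L - 1 := by push_cast; nlinarith
    have h2 : ((K * 2 : ℕ) : ℝ) < ⌊L⌋₊ := by
      have := Nat.sub_one_lt_floor L
      linarith
    exact_mod_cast h2.le
  have hB : χ ≤ 2 * ∑ v ∈ box 4 (⌊L⌋₊ / 2), S v := hχm _ hKn
  set B : ℝ := ∑ v ∈ box 4 (⌊L⌋₊ / 2), S v with hBdef
  have hB1 : 1 ≤ B := by
    calc (1 : ℝ) = S 0 := (twoPointFn_zero μ hS).symm
      _ ≤ B := Finset.single_le_sum (fun v _ => hS0 v) (zero_mem_box 4 _)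
  have hχ0 : 0 ≤ χ := tsum_nonneg hS0
  -- the tree-diagram estimate
  have key := ursellFourSum_le_of_summable hT hS hS0 hsum hL2 hr
  refine key.trans ?_
  have hL0 : 0 < L := by linarith
  have hK1 : (K : ℝ) + 1 ≤ 17 * (L / M) := by linarith
  rw [div_le_div_iff₀ (by positivity) (by positivity)]
  -- `χ⁴ ≤ 4 χ² B²` and `χ² ≤ 4 C₁² (K+1)⁴ ≤ 4 C₁² 17⁴ L⁴/M⁴`
  have h1 : χ ^ 4 ≤ 4 * (2 * (C₁ * ((K : ℝ) + 1) ^ 2)) ^ 2 * B ^ 2 := by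
    calc χ ^ 4 = χ ^ 2 * χ ^ 2 := by ring
      _ ≤ (2 * (C₁ * ((K : ℝ) + 1) ^ 2)) ^ 2 * (2 * B) ^ 2 := by gcongr
      _ = 4 * (2 * (C₁ * ((K : ℝ) + 1) ^ 2)) ^ 2 * B ^ 2 := by ring
  calc 2 * 12 ^ 4 * r ^ 4 * χ ^ 4 * M ^ 4
      ≤ 2 * 12 ^ 4 * r ^ 4 * (4 * (2 * (C₁ * ((K : ℝ) + 1) ^ 2)) ^ 2 * B ^ 2) * M ^ 4 := by
        gcongr
    _ ≤ 2 * 12 ^ 4 * r ^ 4 * (4 * (2 * (C₁ * (17 * (L / M)) ^ 2)) ^ 2 * B ^ 2) * M ^ 4 := by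
        gcongr
    _ = 32 * 12 ^ 4 * 17 ^ 4 * C₁ ^ 2 * r ^ 4 * (L ^ 4 * B ^ 2) := by
        field_simp
        ring

end OffWindow




section Assembly

/-- Making a quotient `A / x` small: for `A ≥ 0`, `ε > 0` and `x ≥ A/ε + 1`, `A / x ≤ ε`.
[folklore] -/
theorem div_le_of_ge {A ε x : ℝ} (hA : 0 ≤ A) (hε : 0 < ε) (hx : A / ε + 1 ≤ x) : A / x ≤ ε := by
  have hx0 : 0 < x := by have := div_nonneg hA hε.le; linarith
  rw [div_le_iff₀ hx0]
  have : A / ε * ε = A := div_mul_cancel₀ A hε.ne'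
  nlinarith

/-- **Uniform smallness of `S(μ; L, r)`, the tree diagram bound being an explicit `d ≥ 3`
hypothesis** (the synthesis described in the module docstring): the tree diagram bound for the
states `μ ∈ 𝒢(β,0)`, `β ≤ β_c`, `d ≥ 3` (the form of `aizenman_treeDiagramBound`), Panis 2023
Cor. 1.8 in the sharp-length window (`panis_ursellFourSum_le_four`, `d = 4`) and Thm 5.5
(`panis_ursellFourSum_le`, `d ≥ 5`), together with the structure of `𝒢(β, 0)` up to `β_c`
(uniqueness `hasUniqueGibbsMeasure_of_lt_criticalBeta`, `hasUniqueGibbsMeasure_criticalBeta`,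
and the free state `exists_freeMeasure`), imply the uniform smallness of `S(μ; L, r)`: for
`d ≥ 4`, `r ≥ 1` and `ε > 0` there is `L₀` with `Σ_L⁻² ∑_{x ∈ Λ_{rL}⁴} |U₄^μ(x)| ≤ ε` for all
`L ≥ L₀`, all `β ∈ [0, β_c]` and all `μ ∈ 𝒢(β, 0)` (a derived statement, printed by no source);
the modified Simon–Lieb inequality, GKS and the infrared bound used on the way are theorems of
the tree. [cite: Panis2023Triviality, Cor. 1.8, Thm. 5.5, §1.2.1 fn. 2] -/
theorem ursellFourSum_uniformlySmall_of_facts'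
    (hT : ∀ {d : ℕ}, 3 ≤ d → ∀ β : ℝ, 0 ≤ β → β ≤ criticalBeta d →
      ∀ μ ∈ isingGibbsMeasures d β 0, ∀ x : Fin 4 → Site d,
        Summable (fun u : Site d => ∏ i, ∫ σ, spinAt (x i) σ * spinAt u σ ∂μ) →
        |connectedFour μ spinAt x| ≤ 2 * ∑' u : Site d, ∏ i, ∫ σ, spinAt (x i) σ * spinAt u σ ∂μ)
    (hP4 : panis_ursellFourSum_le_four) (hP5 : panis_ursellFourSum_le)
    (hU₁ : ∀ {d : ℕ} {β : ℝ}, hasUniqueGibbsMeasure_of_lt_criticalBeta (d := d) (β := β))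
    (hU₂ : ∀ {d : ℕ}, hasUniqueGibbsMeasure_criticalBeta (d := d))
    (hF : ∀ (d : ℕ) {β : ℝ}, exists_freeMeasure d (β := β) 0) :
    ∀ {d : ℕ}, 4 ≤ d → ∀ r : ℝ, 1 ≤ r → ∀ ε : ℝ, 0 < ε → ∃ L₀ : ℝ,
      ∀ (β L : ℝ), 0 ≤ β → β ≤ criticalBeta d → L₀ ≤ L →
      ∀ μ ∈ isingGibbsMeasures d β 0, ursellFourSum μ L r ≤ ε := by
  intro d hd r hr ε hε
  have hd3 : 3 ≤ d := by omega
  have hr0 : 0 < r := one_pos.trans_le hr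
  -- high-temperature scale `β₀` and the small-`β` threshold
  obtain ⟨β₀, hβ₀, hφ₀⟩ := exists_beta_dctIsingPhi_singleton_lt (d := d)
  set A₁ : ℝ := 32 * 12 ^ d * r ^ d with hA₁
  have hA₁0 : 0 ≤ A₁ := by positivity
  have hsmall : ∀ (β L : ℝ), 0 ≤ β → β ≤ β₀ → β ≤ criticalBeta d → A₁ / ε + 2 ≤ L →
      ∀ μ ∈ isingGibbsMeasures d β 0, ursellFourSum μ L r ≤ ε := by
    intro β L hβ hββ₀ hβc hL μ hμ
    have hL2 : 2 ≤ L := by have := div_nonneg hA₁0 hε.le; linarith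
    have hL1 : 1 ≤ L := by linarith
    refine (ursellFourSum_le_of_le_smallBeta hU₁ hU₂ hF hd3 hβ₀ hφ₀ hβ hββ₀ hβc hμ
      (hT hd3 β hβ hβc μ hμ) hL2 hr).trans ?_
    calc 32 * 12 ^ d * r ^ d / L ^ d ≤ A₁ / L :=
          div_le_div_of_nonneg_left hA₁0 (by positivity) (Bound.le_self_pow_of_pos hL1 (by omega))
      _ ≤ ε := div_le_of_ge hA₁0 hε (by linarith)
  rcases hd.eq_or_lt with h4 | hlt
  · -- `d = 4`
    subst h4
    obtain ⟨C₁, hC₁0, hC₁⟩ := exists_sum_box_twoPointFree_le_sq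
    obtain ⟨C, c, γ, hC, hc, hγ, HP⟩ := hP4
    -- the dilation factor `M`
    set A₂ : ℝ := 32 * 12 ^ 4 * 17 ^ 4 * C₁ ^ 2 * r ^ 4 with hA₂
    have hA₂0 : 0 ≤ A₂ := by positivity
    set M : ℝ := max 64 (A₂ / ε + 1) with hM
    have hM64 : 64 ≤ M := le_max_left _ _
    have hM1 : 1 ≤ M := by linarith
    have hM0 : 0 < M := by linarith
    -- the window threshold `E` at scale `L / M`
    set D : ℝ := C * (M * r) ^ γ / ε with hD
    have hD0 : 0 < D := by positivity
    set E : ℝ := Real.exp (D ^ c⁻¹) with hE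
    have hE1 : 1 < E := by
      rw [hE]
      exact Real.one_lt_exp_iff.2 (Real.rpow_pos_of_pos hD0 _)
    refine ⟨max (A₁ / ε + 2) (max (4 * M) (M * E)), fun β L hβ hβc hL μ hμ => ?_⟩
    have hLs : A₁ / ε + 2 ≤ L := (le_max_left _ _).trans hL
    have hL4M : 4 * M ≤ L := ((le_max_left _ _).trans (le_max_right _ _)).trans hL
    have hLME : M * E ≤ L := ((le_max_right _ _).trans (le_max_right _ _)).trans hL
    have hL0 : 0 ≤ L := by linarith
    rcases le_or_gt β β₀ with hββ₀ | hβ₀β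
    · exact hsmall β L hβ hββ₀ hβc hLs μ hμ
    · have hβpos : 0 < β := hβ₀.trans hβ₀β
      by_cases hwin : ∀ S : Finset (Site 4), (0 : Site 4) ∈ S →
          S ⊆ latticeBox 4 (16 * (L / M)) → 1 / 2 ≤ dctIsingPhi 4 β S
      · -- in the window at scale `L/M`: Panis, after dilation
        obtain ⟨hP, hS⟩ := isingGibbsMeasure_twoPoint_of_facts hU₁ hU₂ hF (by norm_num) hβ hβc hμ
        haveI := hP
        have hG : ∀ x y, 0 ≤ ∫ σ, spinAt x σ * spinAt y σ ∂μ := fun x y => by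
          rw [hS x y]
          exact twoPointFree_nonneg hasBoxLimit_isingCorr_free_holds
            (GKSInequalities.gks_one_holds (zdGraph 4)) hβ _
        have hLM : E ≤ L / M := by rwa [le_div_iff₀ hM0, mul_comm]
        have hLM1 : 1 < L / M := hE1.trans_le hLM
        have hdil := ursellFourSum_le_dilate μ hG hM1 hL0 (r := r)
          (one_pos.trans_le (one_le_blockSpinVariance μ hG (by positivity)))
        refine hdil.trans ?_
        have hMr : 1 ≤ M * r := one_le_mul_of_one_le_of_one_le hM1 hr
        refine (HP β (L / M) (M * r) hβ hβc hLM1 hMr (Or.inr hwin) μ hμ).trans ?_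
        -- `C (M r)^γ / (log (L/M))^c ≤ ε`
        have hlog : D ^ c⁻¹ ≤ Real.log (L / M) := by
          rw [Real.le_log_iff_exp_le (by positivity)]
          exact hLM
        have hlogc : D ≤ Real.log (L / M) ^ c := by
          calc D = (D ^ c⁻¹) ^ c := (Real.rpow_inv_rpow hD0.le hc.ne').symm
            _ ≤ Real.log (L / M) ^ c :=
              Real.rpow_le_rpow (Real.rpow_nonneg hD0.le _) hlog hc.le
        have hnum0 : 0 < C * (M * r) ^ γ := by positivity
        calc C * (M * r) ^ γ / Real.log (L / M) ^ c ≤ C * (M * r) ^ γ / D :=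
              div_le_div_of_nonneg_left hnum0.le hD0 hlogc
          _ = ε := by rw [hD]; field_simp
      · -- off the window: the plain tree diagram bound
        push Not at hwin
        obtain ⟨S₀, h0, hS₀, hφ⟩ := hwin
        refine (ursellFourSum_le_offWindow hU₁ hU₂ hF hC₁0 hC₁ hβpos hβc hμ
          (hT (by norm_num) β hβ hβc μ hμ) hM64 hL4M hr h0 hS₀ hφ).trans ?_
        calc 32 * 12 ^ 4 * 17 ^ 4 * C₁ ^ 2 * r ^ 4 / M ^ 4 = A₂ / M ^ 4 := by rw [hA₂]
          _ ≤ A₂ / M := div_le_div_of_nonneg_left hA₂0 hM0 (Bound.le_self_pow_of_pos hM1 (by norm_num))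
          _ ≤ ε := div_le_of_ge hA₂0 hε (le_max_right _ _)
  · -- `d ≥ 5`: Panis's Thm 5.5 above `β₀`
    have hd5 : 5 ≤ d := hlt
    obtain ⟨C, γ, hC, hγ, HP⟩ := hP5 hd5
    set mx : ℝ := max (β₀ ^ (-4 : ℤ)) (β₀ ^ (-2 : ℤ)) with hmx
    have hmx0 : 0 ≤ mx := le_max_of_le_left (zpow_nonneg hβ₀.le _)
    set A₃ : ℝ := C * mx * r ^ γ with hA₃
    have hA₃0 : 0 ≤ A₃ := by positivity
    refine ⟨max (A₁ / ε + 2) (A₃ / ε + 1), fun β L hβ hβc hL μ hμ => ?_⟩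
    have hLs : A₁ / ε + 2 ≤ L := (le_max_left _ _).trans hL
    have hL3 : A₃ / ε + 1 ≤ L := (le_max_right _ _).trans hL
    have hL1 : 1 ≤ L := by have := div_nonneg hA₃0 hε.le; linarith
    rcases le_or_gt β β₀ with hββ₀ | hβ₀β
    · exact hsmall β L hβ hββ₀ hβc hLs μ hμ
    · have hβpos : 0 < β := hβ₀.trans hβ₀β
      refine (HP β L r hβpos hβc hL1 hr μ hμ).trans ?_
      have hmax : max (β ^ (-4 : ℤ)) (β ^ (-2 : ℤ)) ≤ mx := by
        refine max_le_max ?_ ?_ <;>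
        · rw [zpow_neg, zpow_neg, zpow_ofNat, zpow_ofNat]
          exact inv_anti₀ (pow_pos hβ₀ _) (pow_le_pow_left₀ hβ₀.le hβ₀β.le _)
      have hrγ : 0 ≤ r ^ γ := Real.rpow_nonneg hr0.le γ
      calc C * max (β ^ (-4 : ℤ)) (β ^ (-2 : ℤ)) * r ^ γ / L ^ (d - 4)
          ≤ A₃ / L ^ (d - 4) :=
            div_le_div_of_nonneg_right (by
              rw [hA₃]
              exact mul_le_mul_of_nonneg_right (mul_le_mul_of_nonneg_left hmax hC.le) hrγ)
              (by positivity)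
        _ ≤ A₃ / L := div_le_div_of_nonneg_left hA₃0 (by positivity)
            (Bound.le_self_pow_of_pos hL1 (by omega))
        _ ≤ ε := div_le_of_ge hA₃0 hε hL3

/-- **Uniform smallness of `S(μ; L, r)` from the named facts** (the statement described in the
module docstring of `HighDimTrivialityUniform`): Aizenman's tree diagram bound in the
infinite-volume form `aizenman_treeDiagramBound`, Panis 2023 Cor. 1.8
(`panis_ursellFourSum_le_four`) and Thm 5.5
(`panis_ursellFourSum_le`), uniqueness below and at `β_c` and the free state; see
`ursellFourSum_uniformlySmall_of_facts'` for the version with the tree bound as an explicit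
`d ≥ 3` hypothesis (to be fed by the finite-graph named fact of the barrier catalogue once its
infinite-volume reduction lands). [cite: Panis2023Triviality, Cor. 1.8, Thm. 5.5, §1.2.1 fn. 2] -/
theorem ursellFourSum_uniformlySmall_of_facts (hT : aizenman_treeDiagramBound)
    (hP4 : panis_ursellFourSum_le_four) (hP5 : panis_ursellFourSum_le)
    (hU₁ : ∀ {d : ℕ} {β : ℝ}, hasUniqueGibbsMeasure_of_lt_criticalBeta (d := d) (β := β))
    (hU₂ : ∀ {d : ℕ}, hasUniqueGibbsMeasure_criticalBeta (d := d))
    (hF : ∀ (d : ℕ) {β : ℝ}, exists_freeMeasure d (β := β) 0) :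
    ∀ {d : ℕ}, 4 ≤ d → ∀ r : ℝ, 1 ≤ r → ∀ ε : ℝ, 0 < ε → ∃ L₀ : ℝ,
      ∀ (β L : ℝ), 0 ≤ β → β ≤ criticalBeta d → L₀ ≤ L →
      ∀ μ ∈ isingGibbsMeasures d β 0, ursellFourSum μ L r ≤ ε :=
  ursellFourSum_uniformlySmall_of_facts' (fun hd => hT (by omega)) hP4 hP5 hU₁ hU₂ hF

end Assembly

/-! ### Part 8. Aizenman's tree diagram bound in infinite volume

Discharge of the named fact `aizenman_treeDiagramBound` (`HighDimTrivialityUniform`) up to the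
planar critical corner `d = 2`, `β = β_c(2)`: the finite-graph tree diagram bound is the tree
theorem `Literature.Barriers.CriticalPhenomena.treeDiagramBound_holds`; it is transported to
finite volumes of `ℤ^d`, passed to the limit in the free state, and combined with the tree's
uniqueness theorems for `𝒢(β, 0)`. -/

section TreeDiagramInfiniteVolume

/-- **The tree diagram bound in a finite volume of `ℤ^d`, free boundary condition** (Aizenman
1982; Aizenman, CDM 2020, Lemma 8.1 / eq. (8.2): "for the Ising model on any finite graph, at
`h = 0` and `β ≥ 0` … `|U₄(x₁,…,x₄)| ≤ 2 Σ_u ⟨σ_uσ_{x₁}⟩⟨σ_uσ_{x₂}⟩⟨σ_uσ_{x₃}⟩⟨σ_uσ_{x₄}⟩`"): for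
`β ≥ 0`, a finite `Λ ⊆ ℤ^d` and `x₁, …, x₄ ∈ Λ`,
`|U₄^{∅}_{Λ;β,0}(x)| ≤ 2 ∑_{u ∈ Λ} ∏ⱼ ⟨σ_uσ_{xⱼ}⟩^∅_{Λ;β,0}`. The finite-graph inequality is the
tree theorem `Literature.Barriers.CriticalPhenomena.treeDiagramBound_holds` (switching lemma),
applied to the induced graph on `↥Λ`; the free finite-volume state of `Λ` is the Ising model of
that graph (`isingExpect_free_map` along the subtype embedding). [cite: AizenmanCDM2020, Lemma 8.1 and eq. (8.2)] -/
theorem treeDiagramBound_freeFinset {β : ℝ} (hβ : 0 ≤ β) (Λ : Finset (Site d))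
    (x : Fin 4 → Site d) (hx : ∀ i, x i ∈ Λ) :
    |connectedFour (isingMeasure (zdGraph d) Λ β 0 .free) spinAt x| ≤
      2 * ∑ u ∈ Λ, ∏ j, isingTwoPoint (zdGraph d) Λ β 0 .free u (x j) := by
  set φ : ↥Λ ↪ Site d := Function.Embedding.subtype fun x => x ∈ Λ with hφ
  have hmapΛ : (Finset.univ : Finset ↥Λ).map φ = Λ := by
    rw [Finset.univ_eq_attach, hφ, Finset.attach_map_val]
  set y : Fin 4 → ↥Λ := fun i => ⟨x i, hx i⟩ with hy
  have key := Literature.Barriers.CriticalPhenomena.treeDiagramBound_holds (↥Λ)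
    ((zdGraph d).comap φ) β hβ y
  -- expectations of measurable observables: the free state of `Λ` is the model on `↥Λ`
  have hE : ∀ {f : SpinConfig (Site d) → ℝ}, Measurable f →
      isingExpect (zdGraph d) Λ β 0 .free f =
        isingExpect ((zdGraph d).comap φ) Finset.univ β 0 .free
          (fun τ => f (SpinConfig.extendAlong φ τ)) := by
    intro f hf
    have h1 := isingExpect_free_map (G := (zdGraph d).comap φ) (G' := zdGraph d) φ
      (Λ := Finset.univ) (fun a _ b _ => Iff.rfl) β 0 hf
    rw [hmapΛ] at h1
    exact h1
  -- transport the four-point function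
  have hn : nPoint (isingMeasure (zdGraph d) Λ β 0 .free) spinAt x =
      nPoint (isingMeasure ((zdGraph d).comap φ) Finset.univ β 0 .free) spinAt y := by
    change isingExpect (zdGraph d) Λ β 0 .free (fun σ => ∏ i, spinAt (x i) σ) =
      isingExpect ((zdGraph d).comap φ) Finset.univ β 0 .free (fun τ => ∏ i, spinAt (y i) τ)
    rw [hE (Finset.measurable_prod _ fun i _ => measurable_spinAt _)]
    congr 1
    funext τ
    refine Finset.prod_congr rfl fun i _ => ?_
    exact spinAt_extendAlong φ τ (y i)
  -- transport the two-point functions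
  have h2 : ∀ a b : ↥Λ, isingTwoPoint (zdGraph d) Λ β 0 .free (a : Site d) b =
      isingTwoPoint ((zdGraph d).comap φ) Finset.univ β 0 .free a b := by
    intro a b
    have := isingTwoPoint_free_map (G := (zdGraph d).comap φ) (G' := zdGraph d) φ
      (Λ := Finset.univ) (fun a _ b _ => Iff.rfl) β 0 a b
    rw [hmapΛ] at this
    exact this
  have hc : connectedFour (isingMeasure (zdGraph d) Λ β 0 .free) spinAt x =
      connectedFour (isingMeasure ((zdGraph d).comap φ) Finset.univ β 0 .free) spinAt y := by
    simp only [connectedFour, hn]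
    have : ∀ i j, twoPoint (isingMeasure (zdGraph d) Λ β 0 .free) spinAt (x i) (x j) =
        twoPoint (isingMeasure ((zdGraph d).comap φ) Finset.univ β 0 .free) spinAt (y i) (y j) :=
      fun i j => h2 (y i) (y j)
    simp only [this]
  rw [hc]
  refine key.trans (le_of_eq ?_)
  congr 1
  rw [← Finset.sum_coe_sort Λ]
  refine Finset.sum_congr rfl fun u _ => Finset.prod_congr rfl fun j _ => ?_
  exact (h2 u (y j)).symm

/-- **Aizenman's tree diagram bound for the free state `⟨·⟩^∅_{β,0}` on `ℤ^d`, every `d` and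
every `β ≥ 0`** (Aizenman, CMP 86 (1982): the finite-system bound passes to infinite-volume
limits of finite systems; Aizenman, CDM 2020, Lemma 8.1 / eq. (8.2); Aizenman–Duminil-Copin
2021, §1.3 (tree)). Let `μ` be a translation-invariant probability measure whose correlations
are the free box limits, `∫ σ_A dμ = ⟨σ_A⟩^∅_{β,0}` (the free DLR state of
`exists_freeMeasure_holds`). For sites `x₁, …, x₄`, whenever `∑_u ∏ᵢ ⟨σ_{xᵢ}σ_u⟩_μ` converges,
`|U₄^μ(x₁,…,x₄)| ≤ 2 ∑_u ∏ᵢ ⟨σ_{xᵢ}σ_u⟩_μ`. Proof: the finite-volume inequality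
`treeDiagramBound_freeFinset` in the box `Λ_L`; its left side tends to `U₄^μ(x)`
(box limits of spin monomials, `∏ᵢ σ_{zᵢ} = σ_A` with `A` the set of sites of odd
multiplicity, Friedli–Velenik 2017, §3.6.1 and Exercise 3.16), its right side is at most the infinite-volume series
by `0 ≤ ⟨σ_uσ_{xⱼ}⟩^∅_{Λ_L} ≤ ⟨σ₀σ_{xⱼ-u}⟩^∅_β = ⟨σ_{xⱼ}σ_u⟩_μ` (Griffiths I, volume
monotonicity, translation invariance). [cite: AizenmanCDM2020, Lemma 8.1 and eq. (8.2)] [cite: AizenmanDuminilCopinAnnals2021, arXiv:1912.07973 §1.3, display (tree) (p. 6)] -/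
theorem abs_connectedFour_le_treeSum_free {β : ℝ} (hβ : 0 ≤ β)
    (μ : Measure (SpinConfig (Site d))) [IsProbabilityMeasure μ]
    (hTI : IsTranslationInvariantMeasure μ)
    (hcorr : ∀ A : Finset (Site d), spinCorr μ A = freeCorr d β 0 A)
    (x : Fin 4 → Site d)
    (hsum : Summable fun u : Site d => ∏ i, ∫ σ, spinAt (x i) σ * spinAt u σ ∂μ) :
    |connectedFour μ spinAt x| ≤ 2 * ∑' u : Site d, ∏ i, ∫ σ, spinAt (x i) σ * spinAt u σ ∂μ := by
  classical
  -- box limits of spin monomials in the free state: `∏ᵢ σ_{zᵢ} = σ_A`, `A` = sites of odd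
  -- multiplicity (`σ_z² = 1`), and `⟨σ_A⟩^∅_{Λ_L} → freeCorr d β 0 A = ∫ σ_A dμ`
  have hmon : ∀ {n : ℕ} (z : Fin n → Site d),
      Tendsto (fun L : ℕ => ∫ σ, ∏ i, spinAt (z i) σ ∂isingMeasure (zdGraph d) (box d L) β 0 .free)
        atTop (𝓝 (∫ σ, ∏ i, spinAt (z i) σ ∂μ)) := by
    intro n z
    obtain ⟨A, hA⟩ : ∃ A : Finset (Site d), ∀ σ : SpinConfig (Site d),
        ∏ i, spinAt (z i) σ = spinProduct A σ := by
      set S : Finset (Site d) := Finset.univ.image z with hS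
      set c : Site d → ℕ := fun b => (Finset.univ.filter fun i : Fin n => z i = b).card with hc
      refine ⟨S.filter fun b => Odd (c b), fun σ => ?_⟩
      rw [spinProduct, Finset.prod_filter,
        Finset.prod_comp (s := (Finset.univ : Finset (Fin n))) (fun b => spinAt b σ) z]
      exact Finset.prod_congr rfl fun b _ => spinAt_pow_eq_ite b σ _
    simp_rw [hA]
    rw [show (∫ σ, spinProduct A σ ∂μ) = freeCorr d β 0 A from hcorr A]
    exact hasBoxLimit_isingCorr_free_holds (d := d) hβ le_rfl A
  -- the two-point function of `μ`
  have hS : ∀ a b, ∫ σ, spinAt a σ * spinAt b σ ∂μ = twoPointFree d β (b - a) := by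
    intro a b
    rw [integral_spinAt_mul_spinAt_translate μ hTI a b]
    by_cases hv : b - a = 0
    · rw [hv, twoPointFree_zero]; simp
    · have hpair : ∀ σ, spinAt 0 σ * spinAt (b - a) σ = spinProduct {0, b - a} σ := fun σ => by
        rw [spinProduct, Finset.prod_pair (Ne.symm hv)]
      simp_rw [hpair]
      change spinCorr μ {0, b - a} = _
      rw [hcorr, twoPointFree_eq_freeCorr β hv]
  have hSsymm : ∀ a b, twoPointFree d β (b - a) = twoPointFree d β (a - b) := fun a b => by
    rw [← hS a b, ← hS b a]; simp_rw [mul_comm]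
  -- base facts (theorems of the tree)
  have hgks : ∀ {Λ A : Finset (Site d)} {β h : ℝ} {bc : BoundaryCondition (Site d)},
      gks_one (zdGraph d) (Λ := Λ) (A := A) (β := β) (h := h) (bc := bc) :=
    GKSInequalities.gks_one_holds (zdGraph d)
  have hlim : hasBoxLimit_isingCorr_free d := hasBoxLimit_isingCorr_free_holds
  have hmono : isingCorr_free_mono_volume (d := d) := isingCorr_free_mono_volume_holds
  have htr : isingTwoPoint_free_translate (d := d) := isingTwoPoint_free_translate_holds
  -- the right-hand side in terms of `twoPointFree`
  set P : Site d → ℝ := fun u => ∏ i, ∫ σ, spinAt (x i) σ * spinAt u σ ∂μ with hP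
  have hPeq : ∀ u, P u = ∏ i, twoPointFree d β (x i - u) := fun u =>
    Finset.prod_congr rfl fun i _ => by rw [hS, hSsymm]
  have hP0 : ∀ u, 0 ≤ P u := fun u => by
    rw [hPeq]; exact Finset.prod_nonneg fun i _ => twoPointFree_nonneg hlim hgks hβ _
  -- eventually all `x i` lie in the box
  obtain ⟨L₀, hL₀⟩ := exists_forall_subset_box d (Finset.univ.image x)
  have hxbox : ∀ L, L₀ ≤ L → ∀ i, x i ∈ box d L := fun L hL i =>
    hL₀ L hL (Finset.mem_image_of_mem x (Finset.mem_univ i))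
  -- finite-volume bound, uniformly in `L ≥ L₀`
  have hfin : ∀ L, L₀ ≤ L →
      |connectedFour (isingMeasure (zdGraph d) (box d L) β 0 .free) spinAt x| ≤ 2 * ∑' u, P u := by
    intro L hL
    refine (treeDiagramBound_freeFinset hβ (box d L) x (hxbox L hL)).trans ?_
    refine mul_le_mul_of_nonneg_left ?_ zero_le_two
    calc ∑ u ∈ box d L, ∏ j, isingTwoPoint (zdGraph d) (box d L) β 0 .free u (x j)
        ≤ ∑ u ∈ box d L, P u := by
          refine Finset.sum_le_sum fun u hu => ?_
          rw [hPeq]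
          refine Finset.prod_le_prod (fun j _ => isingTwoPoint_free_nonneg hgks hβ hu (hxbox L hL j))
            fun j _ => ?_
          exact isingTwoPoint_free_le_twoPointFree_sub hmono hlim htr hβ hu (hxbox L hL j)
      _ ≤ ∑' u, P u := hsum.sum_le_tsum _ fun u _ => hP0 u
  -- the left-hand side converges
  have hconv : Tendsto (fun L : ℕ => connectedFour (isingMeasure (zdGraph d) (box d L) β 0 .free)
      spinAt x) atTop (𝓝 (connectedFour μ spinAt x)) := by
    have h4 := hmon x
    have h2 : ∀ a b : Site d, Tendsto (fun L : ℕ =>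
        twoPoint (isingMeasure (zdGraph d) (box d L) β 0 .free) spinAt a b) atTop
        (𝓝 (twoPoint μ spinAt a b)) := by
      intro a b
      have h := hmon ![a, b]
      simp only [Fin.prod_univ_two, Matrix.cons_val_zero, Matrix.cons_val_one] at h
      exact h
    simp only [connectedFour, nPoint]
    exact ((h4.sub ((h2 _ _).mul (h2 _ _))).sub ((h2 _ _).mul (h2 _ _))).sub
      ((h2 _ _).mul (h2 _ _))
  -- conclusion
  refine le_of_tendsto hconv.abs ?_
  filter_upwards [eventually_ge_atTop L₀] with L hL
  exact hfin L hL

/-- **Aizenman's tree diagram bound for the Gibbs states at a point of uniqueness**: on `ℤ^d`,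
at `β ≥ 0` and zero field, if `|𝒢(β, 0)| = 1` then every `μ ∈ 𝒢(β, 0)` is the
translation-invariant free state (`exists_freeMeasure_holds`, Friedli–Velenik 2017,
Exercise 3.16 / Thm. 6.26) and `abs_connectedFour_le_treeSum_free` applies:
`|U₄^μ(x₁,…,x₄)| ≤ 2 ∑_u ∏ᵢ ⟨σ_{xᵢ}σ_u⟩_μ` whenever the series converges.
(Aizenman 1982; CDM 2020, Lemma 8.1 / (8.2); ADC 2021, §1.3 (tree).) [cite: AizenmanCDM2020, Lemma 8.1 and eq. (8.2)] [cite: AizenmanDuminilCopinAnnals2021, arXiv:1912.07973 §1.3, display (tree) (p. 6)] -/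
theorem abs_connectedFour_le_treeSum_of_hasUniqueGibbsMeasure {β : ℝ} (hβ : 0 ≤ β)
    (huniq : HasUniqueGibbsMeasure (isingSpecification (zdGraph d) β 0))
    (μ : Measure (SpinConfig (Site d))) (hμ : μ ∈ isingGibbsMeasures d β 0)
    (x : Fin 4 → Site d)
    (hsum : Summable fun u : Site d => ∏ i, ∫ σ, spinAt (x i) σ * spinAt u σ ∂μ) :
    |connectedFour μ spinAt x| ≤ 2 * ∑' u : Site d, ∏ i, ∫ σ, spinAt (x i) σ * spinAt u σ ∂μ := by
  obtain ⟨μf, hμf, hTI, hcorr⟩ := exists_freeMeasure_holds d (β := β) 0 hβ le_rfl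
  have hμeq : μ = μf := huniq.1 hμ hμf
  subst hμeq
  haveI : IsProbabilityMeasure μ := hμ.1
  exact abs_connectedFour_le_treeSum_free hβ μ hTI hcorr x hsum

/-- **`aizenman_treeDiagramBound` for `d ≥ 3`, proved**: for the nearest-neighbour Ising model
on `ℤ^d`, `d ≥ 3`, `0 ≤ β ≤ β_c`, every `μ ∈ 𝒢(β, 0)` and sites `x₁, …, x₄`, whenever
`∑_u ∏ᵢ ⟨σ_{xᵢ}σ_u⟩_μ` converges, `|U₄^μ(x)| ≤ 2 ∑_u ∏ᵢ ⟨σ_{xᵢ}σ_u⟩_μ`. Uniqueness of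
`𝒢(β, 0)` is the tree theorem `hasUniqueGibbsMeasure_of_lt_criticalBeta_holds`
(Lebowitz–Martin-Löf) below `β_c` and `hasUniqueGibbsMeasure_criticalBeta_holds`
(Aizenman–Duminil-Copin–Sidoravicius 2015) at `β_c`. This is the form in which the fact is used
by `HighDimTriviality*` (`d ≥ 4`). (Aizenman 1982; CDM 2020, Lemma 8.1 / (8.2); ADC 2021, §1.3
(tree).) [cite: AizenmanCDM2020, Lemma 8.1 and eq. (8.2)] [cite: AizenmanDuminilCopinAnnals2021, arXiv:1912.07973 §1.3, display (tree) (p. 6)] -/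
theorem aizenman_treeDiagramBound_three_le :
    ∀ {d : ℕ}, 3 ≤ d → ∀ β : ℝ, 0 ≤ β → β ≤ criticalBeta d →
      ∀ μ ∈ isingGibbsMeasures d β 0, ∀ x : Fin 4 → Site d,
        Summable (fun u : Site d => ∏ i, ∫ σ, spinAt (x i) σ * spinAt u σ ∂μ) →
        |connectedFour μ spinAt x| ≤
          2 * ∑' u : Site d, ∏ i, ∫ σ, spinAt (x i) σ * spinAt u σ ∂μ := by
  intro d hd β hβ hβc μ hμ x hsum
  have huniq : HasUniqueGibbsMeasure (isingSpecification (zdGraph d) β 0) := by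
    rcases hβc.lt_or_eq with hlt | heq
    · exact hasUniqueGibbsMeasure_of_lt_criticalBeta_holds (by omega) hβ hlt
    · rw [heq]; exact hasUniqueGibbsMeasure_criticalBeta_holds hd
  exact abs_connectedFour_le_treeSum_of_hasUniqueGibbsMeasure hβ huniq μ hμ x hsum

/-- **`aizenman_treeDiagramBound` strictly below `β_c`, every `d ≥ 2`, proved**: for
`0 ≤ β < β_c(d)` the Gibbs state is unique (`hasUniqueGibbsMeasure_of_lt_criticalBeta_holds`,
Lebowitz–Martin-Löf 1972: `m*(β) = 0 ⇒ |𝒢(β,0)| = 1`), so the tree diagram bound of the free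
state is that of every `μ ∈ 𝒢(β, 0)`. (Aizenman 1982; CDM 2020, Lemma 8.1 / (8.2); ADC 2021,
§1.3 (tree).) [cite: AizenmanCDM2020, Lemma 8.1 and eq. (8.2)] [cite: AizenmanDuminilCopinAnnals2021, arXiv:1912.07973 §1.3, display (tree) (p. 6)] -/
theorem aizenman_treeDiagramBound_lt_criticalBeta :
    ∀ {d : ℕ}, 2 ≤ d → ∀ β : ℝ, 0 ≤ β → β < criticalBeta d →
      ∀ μ ∈ isingGibbsMeasures d β 0, ∀ x : Fin 4 → Site d,
        Summable (fun u : Site d => ∏ i, ∫ σ, spinAt (x i) σ * spinAt u σ ∂μ) →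
        |connectedFour μ spinAt x| ≤
          2 * ∑' u : Site d, ∏ i, ∫ σ, spinAt (x i) σ * spinAt u σ ∂μ :=
  fun hd _β hβ hβc μ hμ x hsum =>
    abs_connectedFour_le_treeSum_of_hasUniqueGibbsMeasure hβ
      (hasUniqueGibbsMeasure_of_lt_criticalBeta_holds hd hβ hβc) μ hμ x hsum

/-- **`aizenman_treeDiagramBound` from uniqueness of the planar critical state.** The only
corner of the fact not covered by `aizenman_treeDiagramBound_three_le` and
`aizenman_treeDiagramBound_lt_criticalBeta` is `d = 2`, `β = β_c(2)`, where the statement for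
every `μ ∈ 𝒢(β_c(2), 0)` needs `|𝒢(β_c(2), 0)| = 1` (continuity of the planar transition:
Yang 1952; Aizenman–Duminil-Copin–Sidoravicius 2015, Thm. 1.2 with the planar input); granting
it, the fact holds. [cite: AizenmanCDM2020, Lemma 8.1 and eq. (8.2)] [cite: AizenmanDuminilCopinAnnals2021, arXiv:1912.07973 §1.3, display (tree) (p. 6)] -/
theorem aizenman_treeDiagramBound_of_hasUniqueGibbsMeasure_two
    (h₂ : HasUniqueGibbsMeasure (isingSpecification (zdGraph 2) (criticalBeta 2) 0)) :
    aizenman_treeDiagramBound := by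
  intro d hd β hβ hβc μ hμ x hsum
  rcases hβc.lt_or_eq with hlt | heq
  · exact aizenman_treeDiagramBound_lt_criticalBeta hd β hβ hlt μ hμ x hsum
  · rcases (show d = 2 ∨ 3 ≤ d by omega) with rfl | hd3
    · subst heq
      exact abs_connectedFour_le_treeSum_of_hasUniqueGibbsMeasure hβ h₂ μ hμ x hsum
    · exact aizenman_treeDiagramBound_three_le hd3 β hβ hβc μ hμ x hsum

/-- **`aizenman_treeDiagramBound` from continuity of the planar magnetisation at `β_c(2)`**:
if `m*(β_c(2)) = 0` then `⟨σ_x⟩⁺_{β_c(2),0} = m*(β_c(2)) = 0` for all `x` (translation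
invariance, `plusExpect_spinAt_eq_spontaneousMagnetization_holds`), hence `|𝒢(β_c(2), 0)| = 1`
by the Lebowitz–Martin-Löf criterion (`hasUniqueGibbsMeasure_of_plusExpect_spinAt_eq_zero_holds`;
Friedli–Velenik 2017, Thm. 3.28), and `aizenman_treeDiagramBound_of_hasUniqueGibbsMeasure_two`
applies. [cite: FriedliVelenik2017, Thm. 3.28, p. 117 and Def. 3.32, p. 120] -/
theorem aizenman_treeDiagramBound_of_spontaneousMagnetization_two
    (hm : spontaneousMagnetization 2 (criticalBeta 2) = 0) : aizenman_treeDiagramBound :=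
  aizenman_treeDiagramBound_of_hasUniqueGibbsMeasure_two
    (hasUniqueGibbsMeasure_of_plusExpect_spinAt_eq_zero_holds (criticalBeta_nonneg 2) fun x =>
      (plusExpect_spinAt_eq_spontaneousMagnetization_holds (criticalBeta_nonneg 2) x).trans hm)

/-- **`aizenman_treeDiagramBound` from the planar named facts** `criticalBeta_two`
(`β_c(2) = ½ log(1 + √2)`; Onsager 1944, Lebowitz 1972) and
`spontaneousMagnetization_two_criticalBetaTwo` (`m*(½ log(1 + √2)) = 0`; Yang 1952) of
`PlanarIsing`: together they give `m*(β_c(2)) = 0`. These two facts are the whole residual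
trust base of `aizenman_treeDiagramBound`. [cite: Yang1952] -/
theorem aizenman_treeDiagramBound_of_planarFacts (h₁ : criticalBeta_two)
    (h₂ : spontaneousMagnetization_two_criticalBetaTwo) : aizenman_treeDiagramBound := by
  refine aizenman_treeDiagramBound_of_spontaneousMagnetization_two ?_
  have h₁' : criticalBeta 2 = criticalBetaTwo := h₁
  rw [h₁']
  exact h₂

/-- **`aizenman_treeDiagramBound` from the Onsager–Yang formula** (`onsager_yang` of
`PlanarIsing`, crit-ising.S16; Benettin–Gallavotti–Jona-Lasinio–Stella 1973): the formula gives
both `β_c(2) = ½ log(1 + √2)` (`criticalBeta_two_of_onsager_yang`) and `m*` vanishing there. [cite: BenettinGallavottiJonaLasinioStella1973, §3 (main result)] -/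
theorem aizenman_treeDiagramBound_of_onsager_yang (h : onsager_yang) :
    aizenman_treeDiagramBound := by
  refine aizenman_treeDiagramBound_of_planarFacts (criticalBeta_two_of_onsager_yang h) ?_
  have h1 := h criticalBetaTwo criticalBetaTwo_pos.le
  change spontaneousMagnetization 2 criticalBetaTwo = 0
  rw [h1, if_neg (lt_irrefl _)]

end TreeDiagramInfiniteVolume

/-- **Aizenman's tree diagram bound in infinite volume, discharged** (the named fact
`aizenman_treeDiagramBound` of `HighDimTrivialityUniform`): for the nearest-neighbour Ising model
on `ℤ^d`, `d ≥ 2`, `0 ≤ β ≤ β_c(d)`, every DLR state `μ ∈ 𝒢(β, 0)` and `x₁, …, x₄ ∈ ℤ^d` with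
`Σ_u ∏ᵢ ⟨σ_{xᵢ}σ_u⟩_μ < ∞`,
`|U₄^μ(x₁, …, x₄)| ≤ 2 Σ_u ⟨σ_{x₁}σ_u⟩_μ ⟨σ_{x₂}σ_u⟩_μ ⟨σ_{x₃}σ_u⟩_μ ⟨σ_{x₄}σ_u⟩_μ`
(Aizenman, Comm. Math. Phys. 86 (1982) 1–48, the tree diagram bound, proved there on finite graphs
at `h = 0`; as printed in Aizenman, CDM 2020, Lemma 8.1 / eq. (8.2), and, in this infinite-volume
form, in Aizenman–Duminil-Copin 2021, §1.3, display (tree), p. 6 of arXiv:1912.07973).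
Every input is a theorem of the tree: the finite-graph bound
(`Literature.Barriers.CriticalPhenomena.treeDiagramBound_holds`), the box limits and uniqueness
theorems behind `aizenman_treeDiagramBound_of_onsager_yang` (all `d ≥ 3`, and `d ≥ 2` below
`β_c`), and, for the planar critical corner `d = 2`, `β = β_c(2)`, the Onsager–Yang formula
`onsager_yang_of_wu toeplitzDet_onsagerSymbol_exp_decay_holds` (`OnsagerSzego`,
`OnsagerToeplitzDecay`), which gives `m*(β_c(2)) = 0` and so `|𝒢(β_c(2), 0)| = 1`
(Lebowitz–Martin-Löf). [cite: AizenmanCMP1982, tree diagram bound (finite graphs, h = 0), via AizenmanCDM2020 Lemma 8.1 / (8.2)] [cite: AizenmanDuminilCopinAnnals2021, arXiv:1912.07973 §1.3, display (tree) (p. 6)] -/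
theorem aizenman_treeDiagramBound_holds : aizenman_treeDiagramBound :=
  aizenman_treeDiagramBound_of_onsager_yang (onsager_yang_of_wu toeplitzDet_onsagerSymbol_exp_decay_holds)

end Literature.Probability.LatticeModels
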